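import Literature.Barriers.ValiantsHypothesis.CT23ExplicitMatrixPowering
import Literature.Computability.AlgebraicComplexity.ArithCircuitVars
import HarnessLib

/-!
# Input normalisation of circuits with projection gates
# (Chatterjee–Tengse arXiv:2309.07612v2, the hidden hypothesis of Lemma 3.5's substitution
# `C_G(pow(i))` in the proof of Thm. 3.1; val-lit t20 g9, X-CT23 engine brick E-n)

Theorem-only (plus plumbing `def`s) companion of
`CT23LowerBoundsFromSuccinctHittingSets.lean` and `CT23ProjCircuitSubstitution.lean` (brick
E-a); NO named facts. Honest framing: circuit bookkeeping for the source's `VPSPACE`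
constructions; it discharges nothing by itself; `VP ≠ VNP` is NOT proved and nothing here bears
on it.

## What and why (registry B43)

The printed proof of Thm. 3.1 ("annihilators of explicit maps", v1 Thm. of §3; held text
`paper:arxiv-2309.07612` p0014.txt:L6–L10) goes through Lemma 3.5 (v1 Lemma 42,
p0015.txt:L80–L102), whose encoder `ROW(i) := LT(i,k)·C_G(pow(i)) + EQ(i,k)·x` FEEDS THE INPUTS
`z` (and the encoding assignments `y := a_l`) OF THE GIVEN CIRCUIT `C_G` BY SUB-CIRCUITS /
CONSTANTS. In the model of Def. 2.19–2.20 (v1 Def. 27–28: a projection gate `proj_{w=b}` may bind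
ANY variable `w`, inputs included) such a substitution is sound only if no projection gate of
`C_G` binds a substituted variable (the side condition `SubstCompat` of brick E-a's
`ProjCircuit.subst`; two-gate counter-example of val-lit p2 g8: `g₁ = x·z`, `g₂ = proj_{z=0} g₁`,
output `g₁ + g₂ = x·z`, whose leaf-substituted copy `z := p` computes `2·x·p`). The typed fact
`CT23_thm_3_1` quantifies — faithfully to print — over ALL fan-in-two projection circuits
encoding `G`. This file closes the gap at LINEAR cost, with no appeal to the `VPSPACE⁰ = VPproj⁰`
equivalence (Prop. 2.29 / [P08b, M11]):

**Input normalisation.** For a block `x : Fin M → σ` of input variables to protect and two blocks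
of FRESH flag variables `p, b : Fin M → σ` (never read, never projected by `Q`), let
`T_l := x_l + (b_l − x_l)·p_l` (`= x_l` at `p_l = 0`, `= b_l` at `p_l = 1`; four sign-constant
fan-in-two gates) and `Θ := (X x_l ↦ T_l)_l`. Build `Q°` from `Q` gate by gate: a prefix computing
the `T_l`; every leaf `X x_l` replaced by (a reference to) `T_l`; arithmetic gates relocated;
`proj_{x_l = β} u ↦ proj_{p_l = 1} (proj_{b_l = β} u)`; projections of other variables kept;
finally `proj_{p_l = 0}` for every `l`. INVARIANT (`foldl_blocks`): every gate value of `Q°` is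
`Θ` of the corresponding value of `Q`, because `Θ` is a ring map fixing constants, commutes with
the projection of any variable outside the three blocks (K1, `aeval_theta_projVar`), and
`(Θ f)|_{b_l := β}|_{p_l := 1} = Θ (f|_{x_l := β})` for `f` not mentioning the flags (K2,
`projVar_projVar_aeval_theta`); at the end `(Θ P)|_{p := 0} = P` (K3, `aeval_clear_aeval_theta`).
Hence `Q°.eval = Q.eval` EXACTLY, `Q°.size = 2·Q.size + 5·M`, fan-in two and sign constants are
kept, and `Q°` projects NO `x_l` (only flags and the other variables `Q` projects).

## Main declarations

* `ProjCircuit.varSet` (+ `vars_eval_subset`: the computed polynomial mentions only variables the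
  circuit READS), `ProjCircuit.projFinset` (`= projVars` as a `Finset`), `card_varSet_le`
  (`≤ 2·size + 1` for fan-in two), `card_projFinset_le`.
* `InputFlags σ M` (blocks `x, p, b`, one injective map), `InputFlags.theta`, (K1)–(K3).
* `InputFlags.normalize Q` with `eval_normalize` (under `FreshFor`: flags not read / projected by
  `Q`), `size_normalize` (`= 2·size + 5·M`), `isFanInTwo_normalize`, `hasSignConstants_normalize`,
  `projVars_normalize_subset`, `x_notMem_projVars_normalize`; existence form
  `ProjCircuit.exists_inputFree`.
* `ProjCircuit.renameCircuit` (embedding along an injection: `eval_renameCircuit = rename`, size,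
  fan-in, sign constants, `projVars`/`varSet` images).
* The `Sum` layout of the statement file (inputs `ι`, workspace `Fin w`): `ProjCircuit.inputFree`
  (rename into `Fin (w + 2M)`, `M = inputCount ≤ 3·size + 1` the number of inputs touched, then
  normalise), `eval_inputFree`, `size_inputFree_le` (`≤ 17·size + 5`), `projVars_inputFree_subset`
  (`⊆ range Sum.inr`), and the packaged **`ProjCircuit.exists_inputFree_sum`**: a fan-in-two
  projection circuit computing `rename Sum.inl U` can be replaced by one with workspace-only
  projections computing the same polynomial, size `≤ 17·size + 5`, constant-free if the original
  is — the hypothesis shape `projVars ⊆ Set.range Sum.inr` the engine's assembly consumes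
  (lead-np RULING (102)(a): `CT23_thm_3_1` by name = engine + this normalisation).

## References

* [ChatterjeeTengse2023] P. Chatterjee, A. Tengse, *Lower Bounds from Succinct Hitting Sets*,
  arXiv:2309.07612v2: Def. 2.19–2.20 (v1 Def. 27–28, p0010.txt:L76), Thm. 3.1 (v1 §3,
  p0014.txt:L6–L10), Lemma 3.5 (v1 Lemma 42, p0015.txt:L80–L102, the step `C_G(pow(i))`).
* [Burgisser2000] P. Bürgisser, *Completeness and Reduction in Algebraic Complexity Theory*,
  Def. 2.1 / Rem. 2.7 (straight-line programs, substitution), for the `ArithCircuit` half.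
* Cell records: val-lit PRINT-ERRATA registry B43 (p2 g8 finding 2026-08-27, lit g10 vet of this
  normalisation); MEMO-p2g8-CT23-engine-hygiene.md; MEMO-t18g7-CT23-engine.md.
-/

noncomputable section

open MvPolynomial

namespace Literature.Barriers.ValiantsHypothesis

open Literature.Computability.AlgebraicComplexity

universe u v

variable {k : Type u} [CommRing k] {σ : Type v} [DecidableEq σ] {M : ℕ}

namespace ProjCircuit

/-! ### The variables READ by a circuit with projection gates -/

section VarSet

/-- The input variables read by a gate: those of its operands (a projection gate reads through
its single operand; the projected variable is BOUND, recorded by `projVars`, not read).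
[cite: ChatterjeeTengse2023, Def. 2.19–2.20 (v1: Def. 27–28)] -/
def Gate.varSet : Gate k σ → Finset σ
  | .arith g => g.varSet
  | .proj _ _ u => u.varSet

/-- The input variables read by a list of gates. [cite: ChatterjeeTengse2023, Def. 2.20 (v1: Def. 28)] -/
def gatesVarSet (gs : List (Gate k σ)) : Finset σ :=
  gs.foldr (fun g S => g.varSet ∪ S) ∅

/-- The input variables read by a circuit with projections: those of its gates and of its output
operand. [cite: ChatterjeeTengse2023, Def. 2.20 (v1: Def. 28)] -/
def varSet (P : ProjCircuit k σ) : Finset σ :=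
  gatesVarSet P.gates ∪ P.output.varSet

omit [CommRing k] in
/-- A gate of the list reads inside the list's read set. [cite: ChatterjeeTengse2023, Def. 2.20 (v1: Def. 28)] -/
theorem varSet_subset_gatesVarSet {gs : List (Gate k σ)} {g : Gate k σ} (hg : g ∈ gs) :
    g.varSet ⊆ gatesVarSet gs := by
  induction gs with
  | nil => simp at hg
  | cons g' gs ih =>
    rw [gatesVarSet, List.foldr_cons]
    rcases List.mem_cons.1 hg with rfl | hg
    · exact Finset.subset_union_left
    · exact (ih hg).trans Finset.subset_union_right

omit [CommRing k] in
/-- The read set of an appended list. [cite: ChatterjeeTengse2023, Def. 2.20 (v1: Def. 28)] -/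
theorem gatesVarSet_append (gs gs' : List (Gate k σ)) :
    gatesVarSet (gs ++ gs') = gatesVarSet gs ∪ gatesVarSet gs' := by
  induction gs with
  | nil => simp [gatesVarSet]
  | cons g gs ih =>
    change g.varSet ∪ gatesVarSet (gs ++ gs') = (g.varSet ∪ gatesVarSet gs) ∪ gatesVarSet gs'
    rw [ih, Finset.union_assoc]

/-- The value of a gate involves only variables of the value list and the variables it reads
(projections add no variables). [cite: ChatterjeeTengse2023, Def. 2.19–2.20 (v1: Def. 27–28)] -/
theorem vars_projGate_eval_subset (vals : List (MvPolynomial σ k)) (S : Finset σ)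
    (h : ∀ v ∈ vals, v.vars ⊆ S) (g : ProjCircuit.Gate k σ) :
    (ProjCircuit.Gate.eval vals g).vars ⊆ S ∪ ProjCircuit.Gate.varSet g := by
  cases g with
  | arith g => exact ArithCircuit.vars_gate_eval_subset vals S h g
  | proj i c u =>
    intro v hv
    exact ArithCircuit.vars_operand_eval_subset vals S h u (mem_vars_projVar hv).1

/-- Every gate value involves only variables read by the gate list.
[cite: ChatterjeeTengse2023, Def. 2.20 (v1: Def. 28)] -/
theorem vars_subset_of_mem_gateValues (gs : List (Gate k σ)) :
    ∀ v ∈ gateValues gs, v.vars ⊆ gatesVarSet gs := by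
  induction gs using List.reverseRecOn with
  | nil => simp [gateValues]
  | append_singleton gs g ih =>
    intro v hv
    rw [gateValues_append_singleton, List.mem_append, List.mem_singleton] at hv
    rw [gatesVarSet_append]
    have hg : gatesVarSet [g] = g.varSet := by simp [gatesVarSet]
    rw [hg]
    rcases hv with hv | rfl
    · exact (ih v hv).trans Finset.subset_union_left
    · exact vars_projGate_eval_subset _ _ ih g

/-- **The polynomial computed by a circuit with projections involves only the variables it
reads.** [cite: ChatterjeeTengse2023, Def. 2.20 (v1: Def. 28)] -/
theorem vars_eval_subset (P : ProjCircuit k σ) : P.eval.vars ⊆ P.varSet := by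
  rw [eval, varSet]
  exact ArithCircuit.vars_operand_eval_subset _ _ (vars_subset_of_mem_gateValues P.gates) P.output

end VarSet

end ProjCircuit

/-! ### The flags of the normalisation and the substitution `Θ` -/

/-- **Input-normalisation data**: the block `x` of input variables to be protected from
projection, and two blocks of FRESH flag variables — `p l` ("`x l` has been projected") and
`b l` ("… to the Boolean value held by `b l`") — all pairwise distinct (one injective map).
[cite: ChatterjeeTengse2023, Def. 2.19–2.20 and Lemma 3.5 (v1: Def. 27–28, Lemma 42)] -/
structure InputFlags (σ : Type v) (M : ℕ) where
  /-- the protected input variables -/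
  x : Fin M → σ
  /-- the "projected?" flags -/
  p : Fin M → σ
  /-- the "projected-to-which-bit" flags -/
  b : Fin M → σ
  /-- all of `x, p, b` are pairwise distinct variables -/
  inj : Function.Injective (Sum.elim x (Sum.elim p b))

namespace InputFlags

variable (F : InputFlags σ M)

omit [DecidableEq σ] in
/-- `x` is injective. [cite: ChatterjeeTengse2023, Def. 2.20 (v1: Def. 28)] -/
theorem x_inj : Function.Injective F.x := fun l l' h => by
  have := @F.inj (Sum.inl l) (Sum.inl l') (by simpa using h)
  simpa using this

omit [DecidableEq σ] in
/-- `p` is injective. [cite: ChatterjeeTengse2023, Def. 2.20 (v1: Def. 28)] -/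
theorem p_inj : Function.Injective F.p := fun l l' h => by
  have := @F.inj (Sum.inr (Sum.inl l)) (Sum.inr (Sum.inl l')) (by simpa using h)
  simpa using this

omit [DecidableEq σ] in
/-- `b` is injective. [cite: ChatterjeeTengse2023, Def. 2.20 (v1: Def. 28)] -/
theorem b_inj : Function.Injective F.b := fun l l' h => by
  have := @F.inj (Sum.inr (Sum.inr l)) (Sum.inr (Sum.inr l')) (by simpa using h)
  simpa using this

omit [DecidableEq σ] in
/-- `x` misses `p`. [cite: ChatterjeeTengse2023, Def. 2.20 (v1: Def. 28)] -/
theorem x_ne_p (l l' : Fin M) : F.x l ≠ F.p l' := fun h => by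
  have := @F.inj (Sum.inl l) (Sum.inr (Sum.inl l')) (by simpa using h)
  simp at this

omit [DecidableEq σ] in
/-- `x` misses `b`. [cite: ChatterjeeTengse2023, Def. 2.20 (v1: Def. 28)] -/
theorem x_ne_b (l l' : Fin M) : F.x l ≠ F.b l' := fun h => by
  have := @F.inj (Sum.inl l) (Sum.inr (Sum.inr l')) (by simpa using h)
  simp at this

omit [DecidableEq σ] in
/-- `p` misses `b`. [cite: ChatterjeeTengse2023, Def. 2.20 (v1: Def. 28)] -/
theorem p_ne_b (l l' : Fin M) : F.p l ≠ F.b l' := fun h => by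
  have := @F.inj (Sum.inr (Sum.inl l)) (Sum.inr (Sum.inr l')) (by simpa using h)
  simp at this

omit [DecidableEq σ] in
/-- `p` misses `x`. [cite: ChatterjeeTengse2023, Def. 2.20 (v1: Def. 28)] -/
theorem p_ne_x (l l' : Fin M) : F.p l ≠ F.x l' := (F.x_ne_p l' l).symm

omit [DecidableEq σ] in
/-- `b` misses `x`. [cite: ChatterjeeTengse2023, Def. 2.20 (v1: Def. 28)] -/
theorem b_ne_x (l l' : Fin M) : F.b l ≠ F.x l' := (F.x_ne_b l' l).symm

omit [DecidableEq σ] in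
/-- `b` misses `p`. [cite: ChatterjeeTengse2023, Def. 2.20 (v1: Def. 28)] -/
theorem b_ne_p (l l' : Fin M) : F.b l ≠ F.p l' := (F.p_ne_b l' l).symm

/-- The guarded input `T_l := x_l + (b_l − x_l)·p_l` (`= x_l` when `p_l = 0`, `= b_l` when
`p_l = 1`), written as the prefix circuit computes it.
[cite: ChatterjeeTengse2023, Lemma 3.5 (v1: Lemma 42, p0015.txt:L80–L102)] -/
def tPoly (l : Fin M) : MvPolynomial σ k :=
  X (F.x l) + (X (F.b l) + (-1 : k) • X (F.x l)) * X (F.p l)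

omit [DecidableEq σ] in
/-- `T_l` under an algebra map. [cite: ChatterjeeTengse2023, Lemma 3.5 (v1: Lemma 42)] -/
theorem aeval_tPoly {A : Type*} [CommRing A] [Algebra k A] (g : σ → A) (l : Fin M) :
    aeval g (F.tPoly (k := k) l) = g (F.x l) + (g (F.b l) + (-1 : k) • g (F.x l)) * g (F.p l) := by
  simp [tPoly]

/-- The substitution `Θ`: `x_l ↦ T_l`, every other variable fixed.
[cite: ChatterjeeTengse2023, Lemma 3.5 (v1: Lemma 42)] -/
def theta : σ → MvPolynomial σ k :=
  onBlock F.x (fun l => F.tPoly (k := k) l) X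

/-- `Θ` on a protected input. [cite: ChatterjeeTengse2023, Lemma 3.5 (v1: Lemma 42)] -/
theorem theta_x (l : Fin M) : F.theta (k := k) (F.x l) = F.tPoly l := by
  rw [theta, onBlock_blk F.x_inj]

/-- `Θ` off the protected block. [cite: ChatterjeeTengse2023, Lemma 3.5 (v1: Lemma 42)] -/
theorem theta_of_ne {v : σ} (hv : ∀ l, F.x l ≠ v) : F.theta (k := k) v = X v := by
  rw [theta, onBlock_of_ne hv]

/-- The variables of `T_l`. [cite: ChatterjeeTengse2023, Lemma 3.5 (v1: Lemma 42)] -/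
theorem mem_vars_tPoly {l : Fin M} {v : σ} (hv : v ∈ (F.tPoly (k := k) l).vars) :
    v = F.x l ∨ v = F.p l ∨ v = F.b l := by
  unfold tPoly at hv
  have hX : ∀ i : σ, ∀ w ∈ (X i : MvPolynomial σ k).vars, w = i := by
    intro i w hw
    classical
    rw [MvPolynomial.vars_def, Multiset.mem_toFinset] at hw
    exact Multiset.mem_singleton.1 (Multiset.mem_of_le (degrees_X' i) hw)
  rcases Finset.mem_union.1 (vars_add_subset _ _ hv) with h | h
  · exact Or.inl (hX _ _ h)
  · rcases Finset.mem_union.1 (vars_mul _ _ h) with h | h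
    · rcases Finset.mem_union.1 (vars_add_subset _ _ h) with h | h
      · exact Or.inr (Or.inr (hX _ _ h))
      · rw [smul_eq_C_mul] at h
        rcases Finset.mem_union.1 (vars_mul _ _ h) with h | h
        · simp at h
        · exact Or.inl (hX _ _ h)
    · exact Or.inr (Or.inl (hX _ _ h))

/-- The variables of `Θ v`: `v` itself or a flag of ITS block.
[cite: ChatterjeeTengse2023, Lemma 3.5 (v1: Lemma 42)] -/
theorem mem_vars_theta {v w : σ} (hw : w ∈ (F.theta (k := k) v).vars) :
    w = v ∨ ∃ l, F.x l = v ∧ (w = F.p l ∨ w = F.b l) := by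
  by_cases hv : ∃ l, F.x l = v
  · obtain ⟨l, rfl⟩ := hv
    rw [theta_x] at hw
    rcases F.mem_vars_tPoly hw with h | h
    · exact Or.inl h
    · exact Or.inr ⟨l, rfl, h⟩
  · rw [F.theta_of_ne (fun l h => hv ⟨l, h⟩)] at hw
    classical
    rw [MvPolynomial.vars_def, Multiset.mem_toFinset] at hw
    exact Or.inl (Multiset.mem_singleton.1 (Multiset.mem_of_le (degrees_X' v) hw))

/-! #### (K1) `Θ` commutes with the projection of any variable that is neither protected nor a flag -/

/-- **(K1)** Projecting a variable `w` outside the three blocks commutes with `Θ`.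
[cite: ChatterjeeTengse2023, Def. 2.19 and Lemma 3.5 (v1: Def. 27, Lemma 42)] -/
theorem aeval_theta_projVar {w : σ} (hx : ∀ l, F.x l ≠ w) (hp : ∀ l, F.p l ≠ w)
    (hb : ∀ l, F.b l ≠ w) (c : k) (f : MvPolynomial σ k) :
    aeval (F.theta (k := k)) (projVar w c f) = projVar w c (aeval F.theta f) := by
  refine aeval_projVar_comm (e := id) c (F.theta_of_ne hx) (fun i' hi' => ?_) f
  refine projVar_eq_self_of_notMem_vars c fun hmem => ?_
  rcases F.mem_vars_theta hmem with h | ⟨l, -, h | h⟩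
  · exact hi' h.symm
  · exact hp l h.symm
  · exact hb l h.symm

/-! #### (K2) projecting a protected input = setting its two flags, after `Θ` -/

/-- **(K2)** For a polynomial not mentioning the flags of block `l`:
`(Θ f)|_{b_l := c}|_{p_l := 1} = Θ (f|_{x_l := c})`.
[cite: ChatterjeeTengse2023, Def. 2.19 and Lemma 3.5 (v1: Def. 27, Lemma 42)] -/
theorem projVar_projVar_aeval_theta {l : Fin M} (c : k) {f : MvPolynomial σ k}
    (hp : F.p l ∉ f.vars) (hb : F.b l ∉ f.vars) :
    projVar (F.p l) 1 (projVar (F.b l) c (aeval (F.theta (k := k)) f)) =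
      aeval F.theta (projVar (F.x l) c f) := by
  -- both sides are ring maps applied to `f`; compare them on constants and on `vars f`
  unfold projVar
  set πp : MvPolynomial σ k →ₐ[k] MvPolynomial σ k :=
    aeval fun j => if j = F.p l then C (1 : k) else X j
  set πb : MvPolynomial σ k →ₐ[k] MvPolynomial σ k :=
    aeval fun j => if j = F.b l then C c else X j
  set πx : MvPolynomial σ k →ₐ[k] MvPolynomial σ k :=
    aeval fun j => if j = F.x l then C c else X j
  set θ : MvPolynomial σ k →ₐ[k] MvPolynomial σ k := aeval (F.theta (k := k))
  change ((πp.comp πb).comp θ : MvPolynomial σ k →+* MvPolynomial σ k) f =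
    ((θ.comp πx : MvPolynomial σ k →ₐ[k] MvPolynomial σ k) : MvPolynomial σ k →+* _) f
  refine hom_congr_vars ?_ (fun i hi _ => ?_) rfl
  · ext r
    simp
  · change πp (πb (θ (X i))) = θ (πx (X i))
    have hθC : ∀ r : k, θ (C r) = C r := fun r => MvPolynomial.algHom_C θ r
    by_cases hix : ∃ l', F.x l' = i
    · obtain ⟨l', rfl⟩ := hix
      have hθx : θ (X (F.x l')) = F.tPoly l' := by simp only [θ, aeval_X, F.theta_x]
      by_cases hll : l' = l
      · subst hll
        have hπx : πx (X (F.x l')) = C c := by simp [πx]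
        rw [hθx, hπx, hθC]
        simp [πb, πp, tPoly, F.x_ne_b, F.x_ne_p, F.p_ne_b]
      · have hne : F.x l' ≠ F.x l := fun h => hll (F.x_inj h)
        have hπx : πx (X (F.x l')) = X (F.x l') := by simp [πx, hne]
        rw [hθx, hπx, hθx]
        simp [πb, πp, tPoly, F.x_ne_b, F.x_ne_p, F.b_ne_p, F.p_ne_b, F.b_inj.eq_iff,
          F.p_inj.eq_iff, hll]
    · have hix' : ∀ l', F.x l' ≠ i := fun l' h => hix ⟨l', h⟩
      have hip : i ≠ F.p l := fun h => hp (h ▸ hi)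
      have hib : i ≠ F.b l := fun h => hb (h ▸ hi)
      have hθi : θ (X i) = X i := by simp only [θ, aeval_X, F.theta_of_ne hix']
      have hπx : πx (X i) = X i := by simp [πx, (hix' l).symm]
      rw [hθi, hπx, hθi]
      simp [πb, πp, hip, hib]

/-! #### (K3) clearing the flags undoes `Θ` -/

/-- The substitution setting the `p`-flags listed in `ls` to `0`.
[cite: ChatterjeeTengse2023, Def. 2.19 (v1: Def. 27)] -/
def clear (ls : List (Fin M)) : σ → MvPolynomial σ k :=
  fun v => if ∃ l ∈ ls, F.p l = v then 0 else X v

/-- `clear` on a listed flag. [cite: ChatterjeeTengse2023, Def. 2.19 (v1: Def. 27)] -/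
theorem clear_p {ls : List (Fin M)} {l : Fin M} (hl : l ∈ ls) : F.clear (k := k) ls (F.p l) = 0 := by
  unfold clear
  rw [if_pos ⟨l, hl, rfl⟩]

/-- `clear` off the listed flags. [cite: ChatterjeeTengse2023, Def. 2.19 (v1: Def. 27)] -/
theorem clear_of_ne {ls : List (Fin M)} {v : σ} (hv : ∀ l ∈ ls, F.p l ≠ v) :
    F.clear (k := k) ls v = X v := by
  unfold clear
  rw [if_neg]
  rintro ⟨l, hl, h⟩
  exact hv l hl h

/-- **(K3)** For a polynomial not mentioning any `p`-flag, clearing ALL `p`-flags after `Θ`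
gives the polynomial back: `(Θ P)|_{p := 0} = P`.
[cite: ChatterjeeTengse2023, Def. 2.19 and Lemma 3.5 (v1: Def. 27, Lemma 42)] -/
theorem aeval_clear_aeval_theta {ls : List (Fin M)} (hls : ∀ l, l ∈ ls) {P : MvPolynomial σ k}
    (hp : ∀ l, F.p l ∉ P.vars) :
    aeval (F.clear (k := k) ls) (aeval (F.theta (k := k)) P) = P := by
  set π : MvPolynomial σ k →ₐ[k] MvPolynomial σ k := aeval (F.clear (k := k) ls)
  set θ : MvPolynomial σ k →ₐ[k] MvPolynomial σ k := aeval (F.theta (k := k))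
  change ((π.comp θ : MvPolynomial σ k →ₐ[k] _) : MvPolynomial σ k →+* _) P =
    (RingHom.id _) P
  refine hom_congr_vars ?_ (fun i hi _ => ?_) rfl
  · ext r
    simp
  · change π (θ (X i)) = X i
    by_cases hix : ∃ l, F.x l = i
    · obtain ⟨l, rfl⟩ := hix
      simp only [θ, π, aeval_X, F.theta_x, F.aeval_tPoly, F.clear_p (hls l),
        F.clear_of_ne (fun l' _ => F.p_ne_x l' l), F.clear_of_ne (fun l' _ => F.p_ne_b l' l),
        mul_zero, add_zero]
    · have hix' : ∀ l', F.x l' ≠ i := fun l' h => hix ⟨l', h⟩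
      have hip : ∀ l ∈ ls, F.p l ≠ i := fun l _ h => hp l (h ▸ hi)
      simp only [θ, π, aeval_X, F.theta_of_ne hix', F.clear_of_ne hip]

end InputFlags

/-! ### The normalised circuit -/

namespace ProjCircuit

namespace InputNorm

/-! #### Relocation of operands and arithmetic gates (uniform doubling of gate indices) -/

/-- Relocate an operand: inputs through `ρ`, a reference to gate `j'` to the SECOND gate of
block `j'`, i.e. index `n + (2 j' + 1)` after a prefix of length `n`.
[cite: ChatterjeeTengse2023, Lemma 3.5 (v1: Lemma 42)] -/
def relocOperand (ρ : σ → ArithCircuit.Operand k σ) (n : ℕ) :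
    ArithCircuit.Operand k σ → ArithCircuit.Operand k σ
  | .var i => ρ i
  | .const c => .const c
  | .gate j => .gate (n + (2 * j + 1))

/-- `relocOperand` on all operands of an arithmetic gate.
[cite: ChatterjeeTengse2023, Lemma 3.5 (v1: Lemma 42)] -/
def relocAGate (ρ : σ → ArithCircuit.Operand k σ) (n : ℕ) :
    ArithCircuit.Gate k σ → ArithCircuit.Gate k σ
  | .sum args => .sum (args.map fun a => (a.1, relocOperand ρ n a.2))
  | .prod args => .prod (args.map (relocOperand ρ n))

/-- The padding gate (empty sum: value `0`, no operands), making every block two gates long.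
[cite: ChatterjeeTengse2023, Def. 2.20 (v1: Def. 28)] -/
def dummy : Gate k σ := .arith (.sum [])

/-- The padding gate evaluates to `0`. [cite: ChatterjeeTengse2023, Def. 2.20 (v1: Def. 28)] -/
@[simp] theorem eval_dummy (vals : List (MvPolynomial σ k)) :
    (dummy : Gate k σ).eval vals = 0 := by
  simp [dummy, Gate.eval, ArithCircuit.Gate.eval]

omit [CommRing k] [DecidableEq σ] in
/-- Relocation does not change fan-in. [cite: ChatterjeeTengse2023, Def. 2.20 (v1: Def. 28)] -/
theorem fanIn_relocAGate (ρ : σ → ArithCircuit.Operand k σ) (n : ℕ) (g : ArithCircuit.Gate k σ) :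
    (relocAGate ρ n g).fanIn = g.fanIn := by
  cases g <;> simp [relocAGate, ArithCircuit.Gate.fanIn, ArithCircuit.Gate.args]

omit [CommRing k] [DecidableEq σ] in
/-- Relocation keeps sign constants (given constant-free operands `ρ i`).
[cite: ChatterjeeTengse2023, Def. 2.20 (v1: Def. 28)] -/
theorem hasSignConstants_relocOperand [Zero k] [One k] [Add k] {ρ : σ → ArithCircuit.Operand k σ}
    (hρ : ∀ i, (ρ i).HasSignConstants) (n : ℕ) {u : ArithCircuit.Operand k σ}
    (h : u.HasSignConstants) : (relocOperand ρ n u).HasSignConstants := by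
  cases u with
  | var i => exact hρ i
  | const c => exact h
  | gate j => trivial

omit [CommRing k] [DecidableEq σ] in
/-- Relocation keeps sign constants of a gate. [cite: ChatterjeeTengse2023, Def. 2.20 (v1: Def. 28)] -/
theorem hasSignConstants_relocAGate [Zero k] [One k] [Add k] {ρ : σ → ArithCircuit.Operand k σ}
    (hρ : ∀ i, (ρ i).HasSignConstants) (n : ℕ) {g : ArithCircuit.Gate k σ}
    (h : g.HasSignConstants) : (relocAGate ρ n g).HasSignConstants := by
  cases g with
  | sum args =>
    intro a ha
    simp only [List.mem_map] at ha
    obtain ⟨a', ha', rfl⟩ := ha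
    exact ⟨(h a' ha').1, hasSignConstants_relocOperand hρ n (h a' ha').2⟩
  | prod args =>
    intro u hu
    simp only [List.mem_map] at hu
    obtain ⟨v, hv, rfl⟩ := hu
    exact hasSignConstants_relocOperand hρ n (h v hv)

omit [DecidableEq σ] in
/-- **Semantics of a relocated operand.** If `ρ i` reads `θ i` off the prefix `pre` and the odd
positions of `es` hold the `θ`-images of the original values `vals`, then the relocated
operand evaluates to the `θ`-image of the original operand value (junk references stay junk).
[cite: ChatterjeeTengse2023, Lemma 3.5 (v1: Lemma 42)] -/
theorem eval_relocOperand {ρ : σ → ArithCircuit.Operand k σ} {pre : List (MvPolynomial σ k)}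
    {θ : σ → MvPolynomial σ k} (hρ : ∀ i ws, (ρ i).eval (pre ++ ws) = θ i)
    (u : ArithCircuit.Operand k σ) {vals es : List (MvPolynomial σ k)}
    (hodd : ∀ j : ℕ, es[2 * j + 1]? = (vals[j]?).map (aeval θ)) :
    (relocOperand ρ pre.length u).eval (pre ++ es) = aeval θ (u.eval vals) := by
  cases u with
  | var i =>
    change (ρ i).eval _ = aeval θ (X i)
    rw [MvPolynomial.aeval_X]
    exact hρ i _
  | const c => simp [relocOperand, ArithCircuit.Operand.eval, MvPolynomial.algebraMap_eq]
  | gate j =>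
    simp only [relocOperand, ArithCircuit.Operand.eval, List.getD_eq_getElem?_getD]
    rw [List.getElem?_append_right (by omega), Nat.add_sub_cancel_left, hodd j]
    cases vals[j]? <;> simp

omit [DecidableEq σ] in
/-- **Semantics of a relocated arithmetic gate** (`aeval θ` commutes with weighted sums and
products). [cite: ChatterjeeTengse2023, Lemma 3.5 (v1: Lemma 42)] -/
theorem eval_relocAGate {ρ : σ → ArithCircuit.Operand k σ} {pre : List (MvPolynomial σ k)}
    {θ : σ → MvPolynomial σ k} (hρ : ∀ i ws, (ρ i).eval (pre ++ ws) = θ i)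
    (g : ArithCircuit.Gate k σ) {vals es : List (MvPolynomial σ k)}
    (hodd : ∀ j : ℕ, es[2 * j + 1]? = (vals[j]?).map (aeval θ)) :
    (relocAGate ρ pre.length g).eval (pre ++ es) = aeval θ (g.eval vals) := by
  cases g with
  | sum args =>
    simp only [relocAGate, ArithCircuit.Gate.eval, List.map_map, map_list_sum]
    congr 1
    simp [Function.comp_def, eval_relocOperand hρ _ hodd]
  | prod args =>
    simp only [relocAGate, ArithCircuit.Gate.eval, List.map_map, map_list_prod]
    congr 1
    simp [Function.comp_def, eval_relocOperand hρ _ hodd]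

/-! #### Tracking invariant of the doubled value list -/

/-- `Tracks θ vals es`: `es` is twice as long as `vals` and its odd positions hold the
`θ`-images of `vals` (even positions are padding / first halves of blocks).
[cite: ChatterjeeTengse2023, Lemma 3.5 (v1: Lemma 42)] -/
def Tracks (θ : σ → MvPolynomial σ k) (vals es : List (MvPolynomial σ k)) : Prop :=
  es.length = 2 * vals.length ∧ ∀ j : ℕ, es[2 * j + 1]? = (vals[j]?).map (aeval θ)

omit [DecidableEq σ] in
/-- The empty lists track each other. [cite: ChatterjeeTengse2023, Lemma 3.5 (v1: Lemma 42)] -/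
theorem Tracks.nil (θ : σ → MvPolynomial σ k) : Tracks θ [] [] := ⟨rfl, fun j => by simp⟩

omit [DecidableEq σ] in
/-- Appending one padding value does not disturb the odd positions.
[cite: ChatterjeeTengse2023, Lemma 3.5 (v1: Lemma 42)] -/
theorem Tracks.odd_snoc {θ : σ → MvPolynomial σ k} {vals es : List (MvPolynomial σ k)}
    (h : Tracks θ vals es) (x : MvPolynomial σ k) (j : ℕ) :
    (es ++ [x])[2 * j + 1]? = (vals[j]?).map (aeval θ) := by
  rw [← h.2 j]
  by_cases hj : 2 * j + 1 < es.length
  · exact List.getElem?_append_left hj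
  · have hne : es.length ≠ 2 * j + 1 := by rw [h.1]; omega
    have h1 : es.length + 1 ≤ 2 * j + 1 := by omega
    rw [List.getElem?_eq_none (by simpa using h1), List.getElem?_eq_none (by omega)]

omit [DecidableEq σ] in
/-- Appending a block `[x, θ w]` tracks appending `w`. [cite: ChatterjeeTengse2023, Lemma 3.5 (v1: Lemma 42)] -/
theorem Tracks.snoc {θ : σ → MvPolynomial σ k} {vals es : List (MvPolynomial σ k)}
    (h : Tracks θ vals es) (x w : MvPolynomial σ k) :
    Tracks θ (vals ++ [w]) (es ++ [x, aeval θ w]) := by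
  refine ⟨by simp only [List.length_append, List.length_cons, List.length_nil, h.1]; omega,
    fun j => ?_⟩
  rcases lt_trichotomy j vals.length with hj | rfl | hj
  · rw [List.getElem?_append_left (by rw [h.1]; omega), List.getElem?_append_left hj, h.2 j]
  · rw [List.getElem?_append_right (by rw [h.1]; omega), h.1,
      show 2 * vals.length + 1 - 2 * vals.length = 1 by omega]
    simp
  · have h3 : (es ++ [x, aeval θ w]).length ≤ 2 * j + 1 := by
      simp only [List.length_append, List.length_cons, List.length_nil, h.1]; omega
    have h4 : (vals ++ [w]).length ≤ j := by
      simp only [List.length_append, List.length_cons, List.length_nil]; omega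
    rw [List.getElem?_eq_none h3, List.getElem?_eq_none h4]
    rfl

end InputNorm

omit [CommRing k] [DecidableEq σ] in
/-- The projection surgery projects one more variable. [cite: ChatterjeeTengse2023, Def. 2.19 (v1: Def. 27)] -/
theorem projVars_projectionCircuit_subset [CommSemiring k] (P : ProjCircuit k σ) (i : σ) (c : Bool) :
    (P.projectionCircuit i c).projVars ⊆ P.projVars ∪ {i} := by
  rintro v ⟨c', u', hg⟩
  simp only [ProjCircuit.projectionCircuit, List.mem_append, List.mem_cons, List.mem_nil_iff,
    or_false, ProjCircuit.Gate.proj.injEq] at hg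
  rcases hg with hg | ⟨rfl, -, -⟩
  · exact Or.inl ⟨c', u', hg⟩
  · exact Or.inr rfl

end ProjCircuit

namespace InputFlags

variable (F : InputFlags σ M)

/-! #### The prefix computing the guarded inputs `T_l` -/

/-- The constant-free circuit of `T_l = x_l + (b_l − x_l)·p_l` (4 gates).
[cite: ChatterjeeTengse2023, Lemma 3.5 (v1: Lemma 42)] -/
def tCircuit (l : Fin M) : ArithCircuit k σ :=
  (ArithCircuit.ofVar (F.x l)).add
    (((ArithCircuit.ofVar (F.b l)).add ((ArithCircuit.ofVar (F.x l)).smul (-1))).mul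
      (ArithCircuit.ofVar (F.p l)))

/-- The `M` guarded-input circuits, juxtaposed as the prefix.
[cite: ChatterjeeTengse2023, Lemma 3.5 (v1: Lemma 42)] -/
def tList : List (ArithCircuit k σ) :=
  (List.finRange M).map (F.tCircuit (k := k))

/-- The prefix gates: the juxtaposition of the `T_l`-circuits, embedded as arithmetic gates.
[cite: ChatterjeeTengse2023, Lemma 3.5 (v1: Lemma 42)] -/
def prefixGates : List (ProjCircuit.Gate k σ) :=
  (ArithCircuit.juxtGates (F.tList (k := k))).map ProjCircuit.Gate.arith

/-- The operands replacing the input leaves: `x_l ↦` the output of the `l`-th prefix circuit,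
every other variable unchanged. [cite: ChatterjeeTengse2023, Lemma 3.5 (v1: Lemma 42)] -/
def leafOperand : σ → ArithCircuit.Operand k σ :=
  onBlock F.x (fun l => (ArithCircuit.juxtOuts (F.tList (k := k))).getD l (.var (F.x l))) .var

omit [DecidableEq σ] in
/-- Semantics of the `T_l`-circuit. [cite: ChatterjeeTengse2023, Lemma 3.5 (v1: Lemma 42)] -/
theorem eval_tCircuit (l : Fin M) : (F.tCircuit (k := k) l).eval = F.tPoly l := by
  simp [tCircuit, tPoly, ArithCircuit.add_eval, ArithCircuit.mul_eval, ArithCircuit.eval_smul,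
    ArithCircuit.eval_ofVar]

omit [DecidableEq σ] in
/-- Four gates each, fan-in two, sign constants. [cite: ChatterjeeTengse2023, Lemma 3.5 (v1: Lemma 42)] -/
theorem tList_spec : ∀ Q ∈ F.tList (k := k), Q.IsFanInTwo ∧ Q.HasSignConstants ∧ Q.size = 4 := by
  intro Q hQ
  simp only [tList, List.mem_map, List.mem_finRange, true_and] at hQ
  obtain ⟨l, rfl⟩ := hQ
  refine ⟨?_, ?_, ?_⟩
  · exact (ArithCircuit.IsFanInTwo.ofVar _).add
      ((((ArithCircuit.IsFanInTwo.ofVar _).add ((ArithCircuit.IsFanInTwo.ofVar _).smul)).mul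
        (ArithCircuit.IsFanInTwo.ofVar _)))
  · exact (ArithCircuit.HasSignConstants.ofVar _).add
      ((((ArithCircuit.HasSignConstants.ofVar _).add
        (ArithCircuit.HasSignConstants.smul ArithCircuit.isSignConstant_neg_one
          (ArithCircuit.HasSignConstants.ofVar _))).mul
        (ArithCircuit.HasSignConstants.ofVar _)))
  · simp [tCircuit, ArithCircuit.size_add, ArithCircuit.size_mul, ArithCircuit.size_smul,
      ArithCircuit.size_ofVar]

omit [DecidableEq σ] in
/-- The prefix has `4M` gates. [cite: ChatterjeeTengse2023, Lemma 3.5 (v1: Lemma 42)] -/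
theorem length_prefixGates : (F.prefixGates (k := k)).length = 4 * M := by
  rw [prefixGates, List.length_map, ArithCircuit.length_juxtGates]
  have : (F.tList (k := k)).map ArithCircuit.size = List.replicate M 4 := by
    apply List.ext_getElem
    · simp [tList]
    · intro i h1 h2
      rw [List.getElem_replicate, List.getElem_map]
      exact (F.tList_spec _ (List.getElem_mem _)).2.2
  rw [this, List.sum_replicate]
  ring

/-- The leaf operands read `Θ` off the prefix values.
[cite: ChatterjeeTengse2023, Lemma 3.5 (v1: Lemma 42)] -/
theorem eval_leafOperand (v : σ) (ws : List (MvPolynomial σ k)) :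
    (F.leafOperand (k := k) v).eval (ProjCircuit.gateValues (F.prefixGates (k := k)) ++ ws) =
      F.theta v := by
  rw [prefixGates, ProjCircuit.gateValues_map_arith]
  have hlen : (F.tList (k := k)).length = M := by simp [tList]
  by_cases hx : ∃ l, F.x l = v
  · obtain ⟨l, rfl⟩ := hx
    have hl : (l : ℕ) < (F.tList (k := k)).length := by omega
    rw [leafOperand, theta, onBlock_blk F.x_inj, onBlock_blk F.x_inj,
      List.getD_eq_getElem _ _ (by simpa using hl), ArithCircuit.eval_juxtOuts _ _ hl]
    simp [tList, eval_tCircuit]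
  · have hx' : ∀ l, F.x l ≠ v := fun l hl => hx ⟨l, hl⟩
    rw [leafOperand, theta, onBlock_of_ne hx', onBlock_of_ne hx']
    rfl

/-- The leaf operands are constant-free. [cite: ChatterjeeTengse2023, Lemma 3.5 (v1: Lemma 42)] -/
theorem hasSignConstants_leafOperand (v : σ) :
    (F.leafOperand (k := k) v).HasSignConstants := by
  unfold leafOperand onBlock
  split_ifs <;> try dsimp only
  · rw [List.getD_eq_getElem?_getD]
    cases h : (ArithCircuit.juxtOuts (F.tList (k := k)))[(↑(Fin.find _ ‹_›) : ℕ)]? with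
    | none => exact ArithCircuit.Operand.hasSignConstants_var _
    | some u =>
      exact ArithCircuit.hasSignConstants_juxtOuts (fun Q hQ => (F.tList_spec Q hQ).2.1) u
        (List.mem_of_getElem? h)
  · exact ArithCircuit.Operand.hasSignConstants_var _

/-! #### The blocks replacing the gates of `Q` -/

/-- The two gates replacing the `j`-th gate of `Q` (after a prefix of length `n`, inputs through
`ρ`): an arithmetic gate is padded and relocated; a projection of a protected input `x_l` becomes
`proj_{b_l = c}` followed by `proj_{p_l = 1}`; any other projection is padded and relocated.
[cite: ChatterjeeTengse2023, Def. 2.19 and Lemma 3.5 (v1: Def. 27, Lemma 42)] -/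
def block (ρ : σ → ArithCircuit.Operand k σ) (n j : ℕ) :
    ProjCircuit.Gate k σ → List (ProjCircuit.Gate k σ)
  | .arith g => [ProjCircuit.InputNorm.dummy, .arith (ProjCircuit.InputNorm.relocAGate ρ n g)]
  | .proj i c u => onBlock F.x
      (fun l => [ProjCircuit.Gate.proj (F.b l) c (ProjCircuit.InputNorm.relocOperand ρ n u),
        ProjCircuit.Gate.proj (F.p l) true (.gate (n + 2 * j))])
      (fun i' => [ProjCircuit.InputNorm.dummy,
        ProjCircuit.Gate.proj i' c (ProjCircuit.InputNorm.relocOperand ρ n u)]) i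

/-- The blocks of all gates from index `j` on. [cite: ChatterjeeTengse2023, Lemma 3.5 (v1: Lemma 42)] -/
def blocks (ρ : σ → ArithCircuit.Operand k σ) (n : ℕ) :
    ℕ → List (ProjCircuit.Gate k σ) → List (ProjCircuit.Gate k σ)
  | _, [] => []
  | j, g :: gs => F.block ρ n j g ++ blocks ρ n (j + 1) gs

omit [CommRing k] in
/-- The block of a projection of the protected input `x_l`. [cite: ChatterjeeTengse2023, Lemma 3.5 (v1: Lemma 42)] -/
theorem block_proj_x (ρ : σ → ArithCircuit.Operand k σ) (n j : ℕ) (l : Fin M) (c : Bool)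
    (u : ArithCircuit.Operand k σ) :
    F.block ρ n j (.proj (F.x l) c u) =
      [ProjCircuit.Gate.proj (F.b l) c (ProjCircuit.InputNorm.relocOperand ρ n u),
        ProjCircuit.Gate.proj (F.p l) true (.gate (n + 2 * j))] := by
  simp only [block]
  rw [onBlock_blk F.x_inj]

omit [CommRing k] in
/-- The block of a projection of an unprotected variable. [cite: ChatterjeeTengse2023, Lemma 3.5 (v1: Lemma 42)] -/
theorem block_proj_of_ne (ρ : σ → ArithCircuit.Operand k σ) (n j : ℕ) {i : σ} (hi : ∀ l, F.x l ≠ i)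
    (c : Bool) (u : ArithCircuit.Operand k σ) :
    F.block ρ n j (.proj i c u) =
      [ProjCircuit.InputNorm.dummy, ProjCircuit.Gate.proj i c (ProjCircuit.InputNorm.relocOperand ρ n u)] := by
  simp only [block]
  rw [onBlock_of_ne hi]

omit [CommRing k] in
/-- Every block has two gates. [cite: ChatterjeeTengse2023, Lemma 3.5 (v1: Lemma 42)] -/
theorem length_block (ρ : σ → ArithCircuit.Operand k σ) (n j : ℕ) (g : ProjCircuit.Gate k σ) :
    (F.block ρ n j g).length = 2 := by
  cases g with
  | arith g => rfl
  | proj i c u =>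
    by_cases hi : ∃ l, F.x l = i
    · obtain ⟨l, rfl⟩ := hi
      rw [F.block_proj_x]; rfl
    · rw [F.block_proj_of_ne _ _ _ (fun l h => hi ⟨l, h⟩)]; rfl

omit [CommRing k] in
/-- The blocks double the gate count. [cite: ChatterjeeTengse2023, Lemma 3.5 (v1: Lemma 42)] -/
theorem length_blocks (ρ : σ → ArithCircuit.Operand k σ) (n : ℕ) (gs : List (ProjCircuit.Gate k σ)) :
    ∀ j, (F.blocks ρ n j gs).length = 2 * gs.length := by
  induction gs with
  | nil => intro j; rfl
  | cons g gs ih =>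
    intro j
    rw [blocks, List.length_append, F.length_block, ih (j + 1), List.length_cons]
    ring

omit [CommRing k] in
/-- A gate of the blocks lies in the block of some original gate.
[cite: ChatterjeeTengse2023, Lemma 3.5 (v1: Lemma 42)] -/
theorem mem_blocks {ρ : σ → ArithCircuit.Operand k σ} {n : ℕ} {gs : List (ProjCircuit.Gate k σ)}
    {g' : ProjCircuit.Gate k σ} :
    ∀ {j}, g' ∈ F.blocks ρ n j gs → ∃ j' g, g ∈ gs ∧ g' ∈ F.block ρ n j' g := by
  induction gs with
  | nil => intro j h; simp [blocks] at h
  | cons g gs ih =>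
    intro j h
    simp only [blocks, List.mem_append] at h
    rcases h with h | h
    · exact ⟨j, g, List.mem_cons_self, h⟩
    · obtain ⟨j', g₀, hg₀, h'⟩ := ih h
      exact ⟨j', g₀, List.mem_cons_of_mem _ hg₀, h'⟩

omit [CommRing k] in
/-- The gates of a block have fan-in at most that of the original gate or `1`.
[cite: ChatterjeeTengse2023, Lemma 3.5 (v1: Lemma 42)] -/
theorem fanIn_le_of_mem_block {ρ : σ → ArithCircuit.Operand k σ} {n j : ℕ}
    {g g' : ProjCircuit.Gate k σ} (h : g' ∈ F.block ρ n j g) : g'.fanIn ≤ max g.fanIn 1 := by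
  cases g with
  | arith g =>
    simp only [block, List.mem_cons, List.mem_nil_iff, or_false] at h
    rcases h with rfl | rfl
    · simp [ProjCircuit.InputNorm.dummy, ProjCircuit.Gate.fanIn, ArithCircuit.Gate.fanIn,
        ArithCircuit.Gate.args]
    · simp [ProjCircuit.Gate.fanIn, ProjCircuit.InputNorm.fanIn_relocAGate]
  | proj i c u =>
    by_cases hi : ∃ l, F.x l = i
    · obtain ⟨l, rfl⟩ := hi
      rw [F.block_proj_x] at h
      simp only [List.mem_cons, List.mem_nil_iff, or_false] at h
      rcases h with rfl | rfl <;> simp [ProjCircuit.Gate.fanIn]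
    · rw [F.block_proj_of_ne _ _ _ (fun l h' => hi ⟨l, h'⟩)] at h
      simp only [List.mem_cons, List.mem_nil_iff, or_false] at h
      rcases h with rfl | rfl
      · simp [ProjCircuit.InputNorm.dummy, ProjCircuit.Gate.fanIn, ArithCircuit.Gate.fanIn,
          ArithCircuit.Gate.args]
      · simp [ProjCircuit.Gate.fanIn]

/-- The gates of a block are constant-free if the original gate and the operands `ρ i` are.
[cite: ChatterjeeTengse2023, Lemma 3.5 (v1: Lemma 42)] -/
theorem hasSignConstants_of_mem_block {ρ : σ → ArithCircuit.Operand k σ}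
    (hρ : ∀ i, (ρ i).HasSignConstants) {n j : ℕ} {g g' : ProjCircuit.Gate k σ}
    (hg : g.HasSignConstants) (h : g' ∈ F.block ρ n j g) : g'.HasSignConstants := by
  cases g with
  | arith g =>
    simp only [block, List.mem_cons, List.mem_nil_iff, or_false] at h
    rcases h with rfl | rfl
    · simp [ProjCircuit.InputNorm.dummy, ProjCircuit.Gate.HasSignConstants,
        ArithCircuit.Gate.HasSignConstants]
    · exact ProjCircuit.InputNorm.hasSignConstants_relocAGate hρ n hg
  | proj i c u =>
    by_cases hi : ∃ l, F.x l = i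
    · obtain ⟨l, rfl⟩ := hi
      rw [F.block_proj_x] at h
      simp only [List.mem_cons, List.mem_nil_iff, or_false] at h
      rcases h with rfl | rfl
      · exact ProjCircuit.InputNorm.hasSignConstants_relocOperand hρ n hg
      · trivial
    · rw [F.block_proj_of_ne _ _ _ (fun l h' => hi ⟨l, h'⟩)] at h
      simp only [List.mem_cons, List.mem_nil_iff, or_false] at h
      rcases h with rfl | rfl
      · simp [ProjCircuit.InputNorm.dummy, ProjCircuit.Gate.HasSignConstants,
          ArithCircuit.Gate.HasSignConstants]
      · exact ProjCircuit.InputNorm.hasSignConstants_relocOperand hρ n hg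

omit [CommRing k] in
/-- The variables a block projects: the flags of a protected input, or the original (unprotected)
projected variable. [cite: ChatterjeeTengse2023, Lemma 3.5 (v1: Lemma 42)] -/
theorem proj_mem_block {ρ : σ → ArithCircuit.Operand k σ} {n j : ℕ} {g : ProjCircuit.Gate k σ}
    {i' : σ} {c' : Bool} {u' : ArithCircuit.Operand k σ}
    (h : ProjCircuit.Gate.proj i' c' u' ∈ F.block ρ n j g) :
    (∃ l, i' = F.p l ∨ i' = F.b l) ∨ ∃ c u, g = ProjCircuit.Gate.proj i' c u ∧ ∀ l, F.x l ≠ i' := by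
  cases g with
  | arith g =>
    simp [block, ProjCircuit.InputNorm.dummy] at h
  | proj i c u =>
    by_cases hi : ∃ l, F.x l = i
    · obtain ⟨l, rfl⟩ := hi
      rw [F.block_proj_x] at h
      simp only [List.mem_cons, List.mem_nil_iff, or_false, ProjCircuit.Gate.proj.injEq] at h
      rcases h with ⟨rfl, -, -⟩ | ⟨rfl, -, -⟩
      · exact Or.inl ⟨l, Or.inr rfl⟩
      · exact Or.inl ⟨l, Or.inl rfl⟩
    · have hi' : ∀ l, F.x l ≠ i := fun l h' => hi ⟨l, h'⟩
      rw [F.block_proj_of_ne _ _ _ hi'] at h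
      simp only [List.mem_cons, List.mem_nil_iff, or_false, ProjCircuit.InputNorm.dummy,
        ProjCircuit.Gate.proj.injEq, reduceCtorEq, false_or] at h
      obtain ⟨rfl, rfl, rfl⟩ := h
      exact Or.inr ⟨_, _, rfl, hi'⟩

/-! #### Semantics of one block and of all blocks -/

/-- **One block**: on a value list `pre ++ es` tracking `vals`, the block of gate `g` (index
`|vals|`) appends a first value and then EXACTLY `Θ (g.eval vals)` — by `eval_relocAGate`
(arithmetic gates), (K1) (projections of unprotected variables) and (K2) (projections of
protected inputs). [cite: ChatterjeeTengse2023, Def. 2.19 and Lemma 3.5 (v1: Def. 27, Lemma 42)] -/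
theorem foldl_block {ρ : σ → ArithCircuit.Operand k σ} {pre : List (MvPolynomial σ k)}
    (hρ : ∀ i ws, (ρ i).eval (pre ++ ws) = F.theta i) {S : Finset σ} (hSp : ∀ l, F.p l ∉ S)
    (hSb : ∀ l, F.b l ∉ S) (g : ProjCircuit.Gate k σ) (hread : g.varSet ⊆ S)
    (hproj : ∀ i c u, g = ProjCircuit.Gate.proj i c u → (∀ l, F.p l ≠ i) ∧ (∀ l, F.b l ≠ i))
    {vals es : List (MvPolynomial σ k)} (hvals : ∀ v ∈ vals, v.vars ⊆ S)
    (htr : ProjCircuit.InputNorm.Tracks F.theta vals es) :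
    ∃ v₁, (F.block ρ pre.length vals.length g).foldl (fun vs g => vs ++ [g.eval vs]) (pre ++ es) =
      pre ++ (es ++ [v₁, aeval F.theta (g.eval vals)]) := by
  cases g with
  | arith g =>
    refine ⟨0, ?_⟩
    have h2 : (ProjCircuit.Gate.arith (ProjCircuit.InputNorm.relocAGate ρ pre.length g)).eval
        (pre ++ (es ++ [0])) = aeval F.theta (g.eval vals) :=
      ProjCircuit.InputNorm.eval_relocAGate hρ g (htr.odd_snoc 0)
    simp only [block, List.foldl_cons, List.foldl_nil, ProjCircuit.InputNorm.eval_dummy,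
      List.append_assoc, List.singleton_append, h2]
    rfl
  | proj i c u =>
    have hvars : (u.eval vals).vars ⊆ S := by
      refine (ArithCircuit.vars_operand_eval_subset vals S hvals u).trans
        (Finset.union_subset le_rfl ?_)
      simpa [ProjCircuit.Gate.varSet] using hread
    have h1 : (ProjCircuit.InputNorm.relocOperand ρ pre.length u).eval (pre ++ es) =
        aeval F.theta (u.eval vals) := ProjCircuit.InputNorm.eval_relocOperand hρ u htr.2
    by_cases hi : ∃ l, F.x l = i
    · obtain ⟨l, rfl⟩ := hi
      rw [F.block_proj_x]
      refine ⟨projVar (F.b l) (if c then 1 else 0) (aeval F.theta (u.eval vals)), ?_⟩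
      have hlen : (pre ++ es).length = pre.length + 2 * vals.length := by simp [htr.1]
      have hg2 : (ProjCircuit.Gate.proj (F.p l) true
          (.gate (pre.length + 2 * vals.length) : ArithCircuit.Operand k σ)).eval
          ((pre ++ es) ++ [projVar (F.b l) (if c then 1 else 0) (aeval F.theta (u.eval vals))]) =
          aeval F.theta (projVar (F.x l) (if c then 1 else 0) (u.eval vals)) := by
        simp only [ProjCircuit.Gate.eval, ArithCircuit.Operand.eval, if_true,
          List.getD_eq_getElem?_getD]
        rw [← hlen, List.getElem?_concat_length, Option.getD_some]
        exact F.projVar_projVar_aeval_theta _ (fun h => hSp l (hvars h)) (fun h => hSb l (hvars h))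
      simp only [List.foldl_cons, List.foldl_nil]
      rw [show (ProjCircuit.Gate.proj (F.b l) c (ProjCircuit.InputNorm.relocOperand ρ pre.length
          u)).eval (pre ++ es) = projVar (F.b l) (if c then 1 else 0) (aeval F.theta (u.eval vals))
          by simp only [ProjCircuit.Gate.eval, h1], hg2]
      simp [ProjCircuit.Gate.eval]
    · have hi' : ∀ l, F.x l ≠ i := fun l h' => hi ⟨l, h'⟩
      obtain ⟨hp, hb⟩ := hproj i c u rfl
      rw [F.block_proj_of_ne _ _ _ hi']
      refine ⟨0, ?_⟩
      have h2 : (ProjCircuit.Gate.proj i c (ProjCircuit.InputNorm.relocOperand ρ pre.length u)).eval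
          (pre ++ (es ++ [0])) = aeval F.theta (projVar i (if c then 1 else 0) (u.eval vals)) := by
        simp only [ProjCircuit.Gate.eval]
        rw [ProjCircuit.InputNorm.eval_relocOperand hρ u (htr.odd_snoc 0),
          F.aeval_theta_projVar hi' hp hb]
      simp only [List.foldl_cons, List.foldl_nil, ProjCircuit.InputNorm.eval_dummy,
        List.append_assoc, List.singleton_append, h2]
      rfl

/-- **All blocks**: folding the blocks of `gs` over `pre ++ es` (tracking `vals`) yields
`pre ++ es'` with `es'` tracking the original fold of `gs` over `vals`.
[cite: ChatterjeeTengse2023, Lemma 3.5 (v1: Lemma 42)] -/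
theorem foldl_blocks {ρ : σ → ArithCircuit.Operand k σ} {pre : List (MvPolynomial σ k)}
    (hρ : ∀ i ws, (ρ i).eval (pre ++ ws) = F.theta i) {S : Finset σ} (hSp : ∀ l, F.p l ∉ S)
    (hSb : ∀ l, F.b l ∉ S) (gs : List (ProjCircuit.Gate k σ)) (hread : ∀ g ∈ gs, g.varSet ⊆ S)
    (hproj : ∀ g ∈ gs, ∀ i c u, g = ProjCircuit.Gate.proj i c u →
      (∀ l, F.p l ≠ i) ∧ (∀ l, F.b l ≠ i))
    {vals es : List (MvPolynomial σ k)} (hvals : ∀ v ∈ vals, v.vars ⊆ S)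
    (htr : ProjCircuit.InputNorm.Tracks F.theta vals es) :
    ∃ es', (F.blocks ρ pre.length vals.length gs).foldl (fun vs g => vs ++ [g.eval vs])
        (pre ++ es) = pre ++ es' ∧
      ProjCircuit.InputNorm.Tracks F.theta (gs.foldl (fun vs g => vs ++ [g.eval vs]) vals) es' := by
  induction gs generalizing vals es with
  | nil => exact ⟨es, rfl, htr⟩
  | cons g gs ih =>
    obtain ⟨v₁, hv₁⟩ := F.foldl_block hρ hSp hSb g (hread g List.mem_cons_self)
      (hproj g List.mem_cons_self) hvals htr
    have hvals' : ∀ v ∈ vals ++ [g.eval vals], v.vars ⊆ S := by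
      intro v hv
      rw [List.mem_append, List.mem_singleton] at hv
      rcases hv with hv | rfl
      · exact hvals v hv
      · exact (ProjCircuit.vars_projGate_eval_subset vals S hvals g).trans
          (Finset.union_subset le_rfl (hread g List.mem_cons_self))
    obtain ⟨es', h1, h2⟩ := ih (fun g' hg' => hread g' (List.mem_cons_of_mem _ hg'))
      (fun g' hg' => hproj g' (List.mem_cons_of_mem _ hg')) hvals' (htr.snoc v₁ (g.eval vals))
    refine ⟨es', ?_, by simpa using h2⟩
    rw [blocks, List.foldl_append, hv₁,
      show vals.length + 1 = (vals ++ [g.eval vals]).length by simp, h1]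

/-! #### The core circuit (prefix + blocks) computes `Θ (Q.eval)` -/

/-- The core of the normalisation: prefix, then the blocks of `Q`, output = the relocated output
operand of `Q`. [cite: ChatterjeeTengse2023, Lemma 3.5 (v1: Lemma 42)] -/
def coreCircuit (Q : ProjCircuit k σ) : ProjCircuit k σ where
  gates := F.prefixGates ++ F.blocks F.leafOperand (F.prefixGates (k := k)).length 0 Q.gates
  output := ProjCircuit.InputNorm.relocOperand F.leafOperand (F.prefixGates (k := k)).length
    Q.output

/-- **The flags are fresh for `Q`**: never read and never projected by `Q` (the protected inputs
`x` may be both). [cite: ChatterjeeTengse2023, Lemma 3.5 (v1: Lemma 42)] -/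
structure FreshFor (Q : ProjCircuit k σ) : Prop where
  /-- no `p`-flag is read by `Q` -/
  p_notMem_varSet : ∀ l, F.p l ∉ Q.varSet
  /-- no `b`-flag is read by `Q` -/
  b_notMem_varSet : ∀ l, F.b l ∉ Q.varSet
  /-- no `p`-flag is projected by `Q` -/
  p_notMem_projVars : ∀ l, F.p l ∉ Q.projVars
  /-- no `b`-flag is projected by `Q` -/
  b_notMem_projVars : ∀ l, F.b l ∉ Q.projVars

/-- **The core circuit computes `Θ (Q.eval)`.** [cite: ChatterjeeTengse2023, Lemma 3.5 (v1: Lemma 42)] -/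
theorem eval_coreCircuit {Q : ProjCircuit k σ} (hF : F.FreshFor (k := k) Q) :
    (F.coreCircuit Q).eval = aeval F.theta Q.eval := by
  have hρ : ∀ i ws, (F.leafOperand (k := k) i).eval
      (ProjCircuit.gateValues (F.prefixGates (k := k)) ++ ws) = F.theta i := F.eval_leafOperand
  have hlen : (F.prefixGates (k := k)).length =
      (ProjCircuit.gateValues (F.prefixGates (k := k))).length :=
    (ProjCircuit.gateValues_length _).symm
  have hread : ∀ g ∈ Q.gates, g.varSet ⊆ Q.varSet := fun g hg =>
    (ProjCircuit.varSet_subset_gatesVarSet hg).trans Finset.subset_union_left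
  have hproj : ∀ g ∈ Q.gates, ∀ i c u, g = ProjCircuit.Gate.proj i c u →
      (∀ l, F.p l ≠ i) ∧ (∀ l, F.b l ≠ i) := by
    rintro g hg i c u rfl
    exact ⟨fun l h => hF.p_notMem_projVars l (h ▸ ⟨c, u, hg⟩),
      fun l h => hF.b_notMem_projVars l (h ▸ ⟨c, u, hg⟩)⟩
  obtain ⟨es', h1, h2⟩ := F.foldl_blocks hρ hF.p_notMem_varSet hF.b_notMem_varSet Q.gates hread
    hproj (vals := []) (es := []) (by simp) (ProjCircuit.InputNorm.Tracks.nil _)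
  have happ : ∀ xs ys : List (ProjCircuit.Gate k σ), ProjCircuit.gateValues (xs ++ ys) =
      ys.foldl (fun vs g => vs ++ [g.eval vs]) (ProjCircuit.gateValues xs) := fun xs ys => by
    simp [ProjCircuit.gateValues, List.foldl_append]
  have hgv : ProjCircuit.gateValues (F.coreCircuit Q).gates =
      ProjCircuit.gateValues (F.prefixGates (k := k)) ++ es' := by
    change ProjCircuit.gateValues (F.prefixGates ++ F.blocks F.leafOperand
      (F.prefixGates (k := k)).length 0 Q.gates) = _
    rw [happ, hlen]
    simpa using h1
  change (ProjCircuit.InputNorm.relocOperand F.leafOperand (F.prefixGates (k := k)).length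
    Q.output).eval (ProjCircuit.gateValues (F.coreCircuit Q).gates) = _
  rw [hgv, hlen, ProjCircuit.InputNorm.eval_relocOperand hρ Q.output h2.2]
  rfl

/-- Size of the core circuit: `4M + 2|Q|`. [cite: ChatterjeeTengse2023, Lemma 3.5 (v1: Lemma 42)] -/
theorem size_coreCircuit (Q : ProjCircuit k σ) : (F.coreCircuit Q).size = 4 * M + 2 * Q.size := by
  simp [coreCircuit, ProjCircuit.size, F.length_blocks, F.length_prefixGates]

/-- Fan-in two is kept. [cite: ChatterjeeTengse2023, Lemma 3.5 (v1: Lemma 42)] -/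
theorem isFanInTwo_coreCircuit {Q : ProjCircuit k σ} (hQ : Q.IsFanInTwo) :
    (F.coreCircuit Q).IsFanInTwo := by
  intro g hg
  simp only [coreCircuit, List.mem_append] at hg
  rcases hg with hg | hg
  · simp only [prefixGates, List.mem_map] at hg
    obtain ⟨g', hg', rfl⟩ := hg
    exact ArithCircuit.fanIn_juxtGates (fun Q hQ => (F.tList_spec Q hQ).1) g' hg'
  · obtain ⟨j', g₀, hg₀, h⟩ := F.mem_blocks hg
    exact (F.fanIn_le_of_mem_block h).trans (max_le (hQ g₀ hg₀) (by norm_num))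

/-- Constant-freeness is kept. [cite: ChatterjeeTengse2023, Lemma 3.5 (v1: Lemma 42)] -/
theorem hasSignConstants_coreCircuit {Q : ProjCircuit k σ} (hQ : Q.HasSignConstants) :
    (F.coreCircuit Q).HasSignConstants := by
  refine ⟨fun g hg => ?_, ProjCircuit.InputNorm.hasSignConstants_relocOperand
    F.hasSignConstants_leafOperand _ hQ.2⟩
  simp only [coreCircuit, List.mem_append] at hg
  rcases hg with hg | hg
  · simp only [prefixGates, List.mem_map] at hg
    obtain ⟨g', hg', rfl⟩ := hg
    exact ArithCircuit.hasSignConstants_juxtGates (fun Q hQ => (F.tList_spec Q hQ).2.1) g' hg'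
  · obtain ⟨j', g₀, hg₀, h⟩ := F.mem_blocks hg
    exact F.hasSignConstants_of_mem_block F.hasSignConstants_leafOperand (hQ.1 g₀ hg₀) h

/-- The core circuit projects only: flags, and the unprotected variables `Q` projects.
[cite: ChatterjeeTengse2023, Lemma 3.5 (v1: Lemma 42)] -/
theorem projVars_coreCircuit_subset (Q : ProjCircuit k σ) :
    (F.coreCircuit Q).projVars ⊆
      (Q.projVars \ Set.range F.x) ∪ (Set.range F.p ∪ Set.range F.b) := by
  rintro v ⟨c', u', hg⟩
  simp only [coreCircuit, List.mem_append] at hg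
  rcases hg with hg | hg
  · simp only [prefixGates, List.mem_map] at hg
    obtain ⟨g', -, h⟩ := hg
    cases h
  · obtain ⟨j', g₀, hg₀, h⟩ := F.mem_blocks hg
    rcases F.proj_mem_block h with ⟨l, rfl | rfl⟩ | ⟨c, u, rfl, hx⟩
    · exact Or.inr (Or.inl ⟨l, rfl⟩)
    · exact Or.inr (Or.inr ⟨l, rfl⟩)
    · exact Or.inl ⟨⟨c, u, hg₀⟩, fun ⟨l, hl⟩ => hx l hl⟩

/-! #### Clearing the flags: `M` projection gates `proj_{p_l = 0}` -/

/-- Append the projections `proj_{p_l = 0}` for `l ∈ ls`.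
[cite: ChatterjeeTengse2023, Def. 2.19 (v1: Def. 27)] -/
def clearCircuit : List (Fin M) → ProjCircuit k σ → ProjCircuit k σ
  | [], P => P
  | l :: ls, P => clearCircuit ls (P.projectionCircuit (F.p l) false)

/-- The clearing gates compute `aeval (clear ls)`. [cite: ChatterjeeTengse2023, Def. 2.19 (v1: Def. 27)] -/
theorem eval_clearCircuit (ls : List (Fin M)) (P : ProjCircuit k σ) :
    (F.clearCircuit ls P).eval = aeval (F.clear (k := k) ls) P.eval := by
  induction ls generalizing P with
  | nil =>
    have : F.clear (k := k) [] = X := by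
      funext v; exact F.clear_of_ne (by simp)
    rw [this, MvPolynomial.aeval_X_left]
    rfl
  | cons l ls ih =>
    rw [clearCircuit, ih, ProjCircuit.eval_projectionCircuit]
    simp only [Bool.false_eq_true, ↓reduceIte, projVar]
    rw [← AlgHom.comp_apply, MvPolynomial.comp_aeval]
    have hfun : (fun i => aeval (F.clear (k := k) ls) (if i = F.p l then C (0 : k) else X i)) =
        F.clear (l :: ls) := by
      funext v
      by_cases hv : v = F.p l
      · subst hv
        simp [F.clear_p (List.mem_cons_self (a := l) (l := ls))]
      rw [if_neg hv, aeval_X]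
      by_cases hv' : ∃ l' ∈ ls, F.p l' = v
      · obtain ⟨l', hl', rfl⟩ := hv'
        rw [F.clear_p hl', F.clear_p (List.mem_cons_of_mem _ hl')]
      · rw [F.clear_of_ne (fun l' hl' h => hv' ⟨l', hl', h⟩), F.clear_of_ne]
        intro l' hl' h
        rcases List.mem_cons.1 hl' with rfl | hl'
        · exact hv h.symm
        · exact hv' ⟨l', hl', h⟩
    rw [hfun]

omit [DecidableEq σ] in
/-- One gate per cleared flag. [cite: ChatterjeeTengse2023, Def. 2.19 (v1: Def. 27)] -/
theorem size_clearCircuit (ls : List (Fin M)) (P : ProjCircuit k σ) :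
    (F.clearCircuit ls P).size = P.size + ls.length := by
  induction ls generalizing P with
  | nil => rfl
  | cons l ls ih =>
    rw [clearCircuit, ih, ProjCircuit.size_projectionCircuit, List.length_cons]
    ring

omit [DecidableEq σ] in
/-- Fan-in two is kept. [cite: ChatterjeeTengse2023, Def. 2.19 (v1: Def. 27)] -/
theorem isFanInTwo_clearCircuit (ls : List (Fin M)) {P : ProjCircuit k σ} (hP : P.IsFanInTwo) :
    (F.clearCircuit ls P).IsFanInTwo := by
  induction ls generalizing P with
  | nil => exact hP
  | cons l ls ih => exact ih (ProjCircuit.isFanInTwo_projectionCircuit hP _ _)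

omit [DecidableEq σ] in
/-- Constant-freeness is kept. [cite: ChatterjeeTengse2023, Def. 2.19 (v1: Def. 27)] -/
theorem hasSignConstants_clearCircuit (ls : List (Fin M)) {P : ProjCircuit k σ}
    (hP : P.HasSignConstants) : (F.clearCircuit ls P).HasSignConstants := by
  induction ls generalizing P with
  | nil => exact hP
  | cons l ls ih => exact ih (ProjCircuit.hasSignConstants_projectionCircuit hP _ _)

omit [DecidableEq σ] in
/-- The clearing gates project only `p`-flags on top of what `P` projects.
[cite: ChatterjeeTengse2023, Def. 2.19 (v1: Def. 27)] -/
theorem projVars_clearCircuit_subset (ls : List (Fin M)) (P : ProjCircuit k σ) :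
    (F.clearCircuit ls P).projVars ⊆ P.projVars ∪ Set.range F.p := by
  induction ls generalizing P with
  | nil => exact Set.subset_union_left
  | cons l ls ih =>
    refine (ih (P.projectionCircuit (F.p l) false)).trans
      (Set.union_subset ?_ Set.subset_union_right)
    refine (ProjCircuit.projVars_projectionCircuit_subset P _ _).trans
      (Set.union_subset Set.subset_union_left ?_)
    rintro v rfl
    exact Or.inr ⟨l, rfl⟩

/-! ### The normalisation and its properties -/

/-- **The input normalisation of `Q`**: prefix (`4M` gates), blocks (`2|Q|` gates), clearing
(`M` gates). [cite: ChatterjeeTengse2023, Def. 2.19–2.20 and Lemma 3.5 (v1: Def. 27–28, Lemma 42)] -/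
def normalize (Q : ProjCircuit k σ) : ProjCircuit k σ :=
  F.clearCircuit (List.finRange M) (F.coreCircuit Q)

/-- **The normalised circuit computes the same polynomial.**
[cite: ChatterjeeTengse2023, Def. 2.19–2.20 and Lemma 3.5 (v1: Def. 27–28, Lemma 42)] -/
theorem eval_normalize {Q : ProjCircuit k σ} (hF : F.FreshFor (k := k) Q) :
    (F.normalize Q).eval = Q.eval := by
  rw [normalize, eval_clearCircuit, F.eval_coreCircuit hF]
  exact F.aeval_clear_aeval_theta (fun l => List.mem_finRange l)
    (fun l h => hF.p_notMem_varSet l (Q.vars_eval_subset h))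

/-- **Size `2|Q| + 5M`.** [cite: ChatterjeeTengse2023, Lemma 3.5 (v1: Lemma 42)] -/
theorem size_normalize (Q : ProjCircuit k σ) : (F.normalize Q).size = 2 * Q.size + 5 * M := by
  rw [normalize, size_clearCircuit, size_coreCircuit, List.length_finRange]
  ring

/-- Fan-in two is kept. [cite: ChatterjeeTengse2023, Lemma 3.5 (v1: Lemma 42)] -/
theorem isFanInTwo_normalize {Q : ProjCircuit k σ} (hQ : Q.IsFanInTwo) :
    (F.normalize Q).IsFanInTwo :=
  F.isFanInTwo_clearCircuit _ (F.isFanInTwo_coreCircuit hQ)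

/-- Constant-freeness is kept. [cite: ChatterjeeTengse2023, Lemma 3.5 (v1: Lemma 42)] -/
theorem hasSignConstants_normalize {Q : ProjCircuit k σ} (hQ : Q.HasSignConstants) :
    (F.normalize Q).HasSignConstants :=
  F.hasSignConstants_clearCircuit _ (F.hasSignConstants_coreCircuit hQ)

/-- **The normalised circuit projects no protected input**: only flags and the unprotected
variables `Q` projects. [cite: ChatterjeeTengse2023, Def. 2.19 and Lemma 3.5 (v1: Def. 27, Lemma 42)] -/
theorem projVars_normalize_subset (Q : ProjCircuit k σ) :
    (F.normalize Q).projVars ⊆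
      (Q.projVars \ Set.range F.x) ∪ (Set.range F.p ∪ Set.range F.b) := by
  refine (F.projVars_clearCircuit_subset _ _).trans (Set.union_subset ?_ ?_)
  · exact F.projVars_coreCircuit_subset Q
  · exact Set.subset_union_left.trans Set.subset_union_right

/-- In particular no protected input is projected. [cite: ChatterjeeTengse2023, Lemma 3.5 (v1: Lemma 42)] -/
theorem x_notMem_projVars_normalize (Q : ProjCircuit k σ) (l : Fin M) :
    F.x l ∉ (F.normalize Q).projVars := by
  intro h
  rcases F.projVars_normalize_subset Q h with ⟨-, h⟩ | ⟨l', h⟩ | ⟨l', h⟩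
  · exact h ⟨l, rfl⟩
  · exact F.x_ne_p l l' h.symm
  · exact F.x_ne_b l l' h.symm

end InputFlags

/-! ### Summary statement -/

/-- **Input normalisation (existence form).** For every circuit with projection gates `Q` and
every block of input variables `x` with `2M` fresh flags, there is a circuit of size
`2|Q| + 5M` computing the same polynomial, with fan-in two / sign constants if `Q` has them,
that projects NO variable of the block `x` (only flags and the other variables `Q` projects).
This discharges the side condition of the substitution step `C_G(pow(i))` in the printed proof
of Thm. 3.1 (Lemma 3.5) for an ARBITRARY encoder.
[cite: ChatterjeeTengse2023, Thm. 3.1 via Lemma 3.5 (v1: Lemma 42)] -/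
theorem ProjCircuit.exists_inputFree (F : InputFlags σ M) (Q : ProjCircuit k σ)
    (hF : F.FreshFor (k := k) Q) :
    ∃ Q' : ProjCircuit k σ, Q'.eval = Q.eval ∧ Q'.size = 2 * Q.size + 5 * M ∧
      (Q.IsFanInTwo → Q'.IsFanInTwo) ∧ (Q.HasSignConstants → Q'.HasSignConstants) ∧
      (∀ l, F.x l ∉ Q'.projVars) ∧
      Q'.projVars ⊆ (Q.projVars \ Set.range F.x) ∪ (Set.range F.p ∪ Set.range F.b) :=
  ⟨F.normalize Q, F.eval_normalize hF, F.size_normalize Q, F.isFanInTwo_normalize,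
    F.hasSignConstants_normalize, F.x_notMem_projVars_normalize Q, F.projVars_normalize_subset Q⟩

/-! ### Renaming a circuit with projections along an injection (embedding into a bigger
variable type, where fresh flags exist) -/

namespace ProjCircuit

section Rename

universe uτ

variable {τ : Type uτ} [DecidableEq τ]

/-- Rename every variable (read or projected) of `Q` along `e` (brick E-a's `subst` with an
empty prefix and variable operands). [cite: ChatterjeeTengse2023, Def. 2.20 (v1: Def. 28)] -/
def renameCircuit (Q : ProjCircuit k σ) (e : σ → τ) : ProjCircuit k τ :=
  Q.subst [] e (fun i => .var (e i))

/-- Renaming along an injection computes the renamed polynomial.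
[cite: ChatterjeeTengse2023, Def. 2.20 (v1: Def. 28)] -/
theorem eval_renameCircuit (Q : ProjCircuit k σ) {e : σ → τ} (he : Function.Injective e) :
    (Q.renameCircuit e).eval = rename e Q.eval := by
  have hX : ∀ (i' : σ) (v : τ), v ∈ (X (e i') : MvPolynomial τ k).vars → v = e i' := by
    intro i' v hv
    classical
    rw [MvPolynomial.vars_def, Multiset.mem_toFinset] at hv
    exact Multiset.mem_singleton.1 (Multiset.mem_of_le (degrees_X' (e i')) hv)
  have h := eval_subst Q [] (e := e) (ρ := fun i => ArithCircuit.Operand.var (e i))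
    (h := fun i => X (e i)) (fun i ws => rfl)
    (substCompat_of_vars Q (fun i _ => rfl) (fun i _ i' hi' hmem => hi' (he (hX i' _ hmem)).symm))
  rw [renameCircuit, h]
  refine DFunLike.congr_fun (MvPolynomial.algHom_ext fun i => ?_) Q.eval
  simp

omit [CommRing k] [DecidableEq σ] [DecidableEq τ] in
/-- Renaming keeps the size. [cite: ChatterjeeTengse2023, Def. 2.20 (v1: Def. 28)] -/
@[simp] theorem size_renameCircuit (Q : ProjCircuit k σ) (e : σ → τ) :
    (Q.renameCircuit e).size = Q.size := by
  simp [renameCircuit]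

omit [CommRing k] [DecidableEq σ] [DecidableEq τ] in
/-- Renaming keeps fan-in two. [cite: ChatterjeeTengse2023, Def. 2.20 (v1: Def. 28)] -/
theorem isFanInTwo_renameCircuit {Q : ProjCircuit k σ} (h : Q.IsFanInTwo) (e : σ → τ) :
    (Q.renameCircuit e).IsFanInTwo :=
  isFanInTwo_subst h (by simp) e _

omit [DecidableEq σ] [DecidableEq τ] in
/-- Renaming keeps sign constants. [cite: ChatterjeeTengse2023, Def. 2.20 (v1: Def. 28)] -/
theorem hasSignConstants_renameCircuit {Q : ProjCircuit k σ} (h : Q.HasSignConstants) (e : σ → τ) :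
    (Q.renameCircuit e).HasSignConstants :=
  hasSignConstants_subst h (by simp) e (fun i => ArithCircuit.Operand.hasSignConstants_var _)

omit [CommRing k] [DecidableEq σ] [DecidableEq τ] in
/-- Renaming maps the projected variables. [cite: ChatterjeeTengse2023, Def. 2.19–2.20 (v1: Def. 27–28)] -/
theorem projVars_renameCircuit_subset (Q : ProjCircuit k σ) (e : σ → τ) :
    (Q.renameCircuit e).projVars ⊆ e '' Q.projVars := by
  rintro v ⟨c, u, hg⟩
  simp only [renameCircuit, subst, List.nil_append, List.mem_map] at hg
  obtain ⟨g, hg, hge⟩ := hg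
  cases g with
  | arith g => simp [Gate.subst] at hge
  | proj i b u' =>
    simp only [Gate.subst, Gate.proj.injEq] at hge
    obtain ⟨rfl, -, -⟩ := hge
    exact ⟨i, ⟨b, u', hg⟩, rfl⟩

omit [CommRing k] in
/-- The variables read by a list of renamed operands. [cite: ChatterjeeTengse2023, Def. 2.20 (v1: Def. 28)] -/
theorem operandsVarSet_map_subst_subset (e : σ → τ) (n : ℕ) (us : List (ArithCircuit.Operand k σ)) :
    ArithCircuit.operandsVarSet (us.map (ArithCircuit.Operand.subst (fun i => .var (e i)) n)) ⊆
      (ArithCircuit.operandsVarSet us).image e := by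
  induction us with
  | nil => simp [ArithCircuit.operandsVarSet]
  | cons u us ih =>
    rw [List.map_cons, ArithCircuit.operandsVarSet, List.foldr_cons, ArithCircuit.operandsVarSet,
      List.foldr_cons, Finset.image_union]
    refine Finset.union_subset_union ?_ ih
    cases u with
    | var i => simp [ArithCircuit.Operand.subst, ArithCircuit.Operand.varSet]
    | const c => simp [ArithCircuit.Operand.subst, ArithCircuit.Operand.varSet]
    | gate j => simp [ArithCircuit.Operand.subst, ArithCircuit.Operand.varSet]

omit [CommRing k] in
/-- The variables read by a renamed gate. [cite: ChatterjeeTengse2023, Def. 2.20 (v1: Def. 28)] -/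
theorem varSet_gate_subst_subset (e : σ → τ) (n : ℕ) (g : Gate k σ) :
    (Gate.subst e (fun i => .var (e i)) n g).varSet ⊆ g.varSet.image e := by
  cases g with
  | arith g =>
    cases g with
    | sum args =>
      simp only [Gate.subst, ArithCircuit.Gate.subst, Gate.varSet, ArithCircuit.Gate.varSet,
        ArithCircuit.Gate.args, List.map_map]
      have := operandsVarSet_map_subst_subset (k := k) e n (args.map Prod.snd)
      rw [List.map_map] at this
      exact this
    | prod args =>
      simp only [Gate.subst, ArithCircuit.Gate.subst, Gate.varSet, ArithCircuit.Gate.varSet,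
        ArithCircuit.Gate.args]
      exact operandsVarSet_map_subst_subset e n args
  | proj i b u =>
    cases u with
    | var i => simp [Gate.subst, Gate.varSet, ArithCircuit.Operand.subst, ArithCircuit.Operand.varSet]
    | const c => simp [Gate.subst, Gate.varSet, ArithCircuit.Operand.subst,
        ArithCircuit.Operand.varSet]
    | gate j => simp [Gate.subst, Gate.varSet, ArithCircuit.Operand.subst,
        ArithCircuit.Operand.varSet]

omit [CommRing k] in
/-- Renaming maps the read variables. [cite: ChatterjeeTengse2023, Def. 2.20 (v1: Def. 28)] -/
theorem varSet_renameCircuit_subset (Q : ProjCircuit k σ) (e : σ → τ) :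
    (Q.renameCircuit e).varSet ⊆ Q.varSet.image e := by
  rw [varSet, varSet, Finset.image_union]
  refine Finset.union_subset_union ?_ ?_
  · simp only [renameCircuit, subst, List.nil_append]
    induction Q.gates with
    | nil => simp [gatesVarSet]
    | cons g gs ih =>
      rw [List.map_cons, gatesVarSet, List.foldr_cons, gatesVarSet, List.foldr_cons,
        Finset.image_union]
      exact Finset.union_subset_union (varSet_gate_subst_subset e _ g) ih
  · cases hQ : Q.output with
    | var i => simp [renameCircuit, subst, hQ, ArithCircuit.Operand.subst,
        ArithCircuit.Operand.varSet]
    | const c => simp [renameCircuit, subst, hQ, ArithCircuit.Operand.subst,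
        ArithCircuit.Operand.varSet]
    | gate j => simp [renameCircuit, subst, hQ, ArithCircuit.Operand.subst,
        ArithCircuit.Operand.varSet]

end Rename

/-! ### The projected variables as a finite set; counting the variables a circuit touches -/

section Count

omit [CommRing k] [DecidableEq σ] in
/-- The variable a gate projects, if any. [cite: ChatterjeeTengse2023, Def. 2.19 (v1: Def. 27)] -/
def Gate.projVar? : Gate k σ → Option σ
  | .proj i _ _ => some i
  | .arith _ => none

/-- The finite set of variables `Q` projects (`= Q.projVars`).
[cite: ChatterjeeTengse2023, Def. 2.19 (v1: Def. 27)] -/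
def projFinset (Q : ProjCircuit k σ) : Finset σ :=
  (Q.gates.filterMap Gate.projVar?).toFinset

omit [CommRing k] in
/-- `projFinset` is `projVars`. [cite: ChatterjeeTengse2023, Def. 2.19 (v1: Def. 27)] -/
theorem mem_projFinset_iff {Q : ProjCircuit k σ} {i : σ} : i ∈ Q.projFinset ↔ i ∈ Q.projVars := by
  simp only [projFinset, List.mem_toFinset, List.mem_filterMap, projVars, Set.mem_setOf_eq]
  constructor
  · rintro ⟨g, hg, h⟩
    cases g with
    | arith g => simp [Gate.projVar?] at h
    | proj i' b u =>
      simp only [Gate.projVar?, Option.some.injEq] at h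
      subst h
      exact ⟨b, u, hg⟩
  · rintro ⟨b, u, hg⟩
    exact ⟨_, hg, rfl⟩

omit [CommRing k] in
/-- At most one projected variable per gate. [cite: ChatterjeeTengse2023, Def. 2.19 (v1: Def. 27)] -/
theorem card_projFinset_le (Q : ProjCircuit k σ) : Q.projFinset.card ≤ Q.size :=
  (List.toFinset_card_le _).trans (List.length_filterMap_le _ _)

omit [CommRing k] in
/-- A gate reads at most `fanIn` variables. [cite: ChatterjeeTengse2023, Def. 2.1 (v1: Def. 9)] -/
theorem card_varSet_projGate_le (g : ProjCircuit.Gate k σ) :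
    (ProjCircuit.Gate.varSet g).card ≤ ProjCircuit.Gate.fanIn g := by
  cases g with
  | arith g => exact ArithCircuit.Gate.card_varSet_le g
  | proj i b u => exact (ArithCircuit.Operand.card_varSet_le u).trans (le_of_eq rfl)

omit [CommRing k] in
/-- A list of gates of fan-in `≤ 2` reads at most twice as many variables as it has gates.
[cite: ChatterjeeTengse2023, Def. 2.1 (v1: Def. 9)] -/
theorem card_gatesVarSet_le (gs : List (Gate k σ)) (h : ∀ g ∈ gs, g.fanIn ≤ 2) :
    (gatesVarSet gs).card ≤ 2 * gs.length := by
  induction gs with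
  | nil => simp [gatesVarSet]
  | cons g gs ih =>
    rw [gatesVarSet, List.foldr_cons, List.length_cons]
    refine (Finset.card_union_le _ _).trans ?_
    have h1 := (card_varSet_projGate_le (k := k) g).trans (h g List.mem_cons_self)
    have h2 : (List.foldr (fun g S => Gate.varSet g ∪ S) ∅ gs).card ≤ 2 * gs.length :=
      ih fun g' hg' => h g' (List.mem_cons_of_mem _ hg')
    omega

omit [CommRing k] in
/-- **A fan-in-two circuit with projections of size `s` reads at most `2s + 1` variables.**
[cite: ChatterjeeTengse2023, Def. 2.1 and Def. 2.20 (v1: Def. 9, 28)] -/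
theorem card_varSet_le (Q : ProjCircuit k σ) (h : Q.IsFanInTwo) : Q.varSet.card ≤ 2 * Q.size + 1 := by
  rw [varSet, size]
  refine (Finset.card_union_le _ _).trans ?_
  have h1 := card_gatesVarSet_le Q.gates h
  have h2 := ArithCircuit.Operand.card_varSet_le (k := k) Q.output
  omega

end Count

/-! ### The `Sum` layout of the statement file: inputs `ι`, workspace `Fin w` -/

section SumLayout

variable {ι : Type v} [DecidableEq ι] {w : ℕ}

/-- The input variables `Q` touches (reads or projects).
[cite: ChatterjeeTengse2023, Lemma 3.5 (v1: Lemma 42)] -/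
def touched (Q : ProjCircuit k (ι ⊕ Fin w)) : Finset ι :=
  (Q.varSet ∪ Q.projFinset).toLeft

/-- The number of input variables `Q` touches. [cite: ChatterjeeTengse2023, Lemma 3.5 (v1: Lemma 42)] -/
def inputCount (Q : ProjCircuit k (ι ⊕ Fin w)) : ℕ := Q.touched.card

omit [CommRing k] in
/-- A fan-in-two circuit of size `s` touches at most `3s + 1` input variables.
[cite: ChatterjeeTengse2023, Def. 2.1 and Lemma 3.5 (v1: Def. 9, Lemma 42)] -/
theorem inputCount_le {Q : ProjCircuit k (ι ⊕ Fin w)} (h2 : Q.IsFanInTwo) :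
    Q.inputCount ≤ 3 * Q.size + 1 := by
  rw [inputCount, touched]
  refine Finset.card_toLeft_le.trans ((Finset.card_union_le _ _).trans ?_)
  have := Q.card_varSet_le h2
  have := Q.card_projFinset_le
  omega

/-- The embedding of the variables into the enlarged workspace (`2M` fresh flags at the end).
[cite: ChatterjeeTengse2023, Lemma 3.5 (v1: Lemma 42)] -/
def embed (M : ℕ) : ι ⊕ Fin w → ι ⊕ Fin (w + 2 * M) := Sum.map id (Fin.castAdd (2 * M))

omit [DecidableEq ι] in
/-- The embedding is injective. [cite: ChatterjeeTengse2023, Lemma 3.5 (v1: Lemma 42)] -/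
theorem embed_injective (M : ℕ) : Function.Injective (embed (ι := ι) (w := w) M) :=
  Sum.map_injective.2 ⟨fun _ _ h => h, Fin.castAdd_injective _ _⟩

omit [DecidableEq ι] in
/-- Fresh workspace variables are outside the range of the embedding.
[cite: ChatterjeeTengse2023, Lemma 3.5 (v1: Lemma 42)] -/
theorem natAdd_notMem_range_embed (M : ℕ) (j : Fin (2 * M)) :
    (Sum.inr (Fin.natAdd w j) : ι ⊕ Fin (w + 2 * M)) ∉ Set.range (embed (ι := ι) (w := w) M) := by
  rintro ⟨v, hv⟩
  cases v with
  | inl i => simp [embed] at hv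
  | inr j' =>
    simp only [embed, Sum.map_inr, Sum.inr.injEq] at hv
    have := congrArg Fin.val hv
    simp at this
    omega

omit [DecidableEq ι] in
/-- The embedding fixes the input variables: embedded input polynomials are input polynomials.
[cite: ChatterjeeTengse2023, Lemma 3.5 (v1: Lemma 42)] -/
theorem rename_embed_rename_inl (M : ℕ) (U : MvPolynomial ι k) :
    rename (embed (w := w) M) (rename Sum.inl U) = rename Sum.inl U := by
  rw [rename_rename]
  rfl

/-- The flags of the `Sum` layout: `x` enumerates the touched inputs, `p`/`b` are the even/odd
fresh workspace variables. [cite: ChatterjeeTengse2023, Lemma 3.5 (v1: Lemma 42)] -/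
def sumFlags (Q : ProjCircuit k (ι ⊕ Fin w)) :
    InputFlags (ι ⊕ Fin (w + 2 * Q.inputCount)) Q.inputCount where
  x := fun l => Sum.inl ((Q.touched.equivFin.symm l : Q.touched) : ι)
  p := fun l => Sum.inr (Fin.natAdd w ⟨2 * l, by have := l.2; omega⟩)
  b := fun l => Sum.inr (Fin.natAdd w ⟨2 * l + 1, by have := l.2; omega⟩)
  inj := by
    rintro (l | l | l) (l' | l' | l') h
    all_goals simp only [Sum.elim_inl, Sum.elim_inr, Sum.inl.injEq, Sum.inr.injEq,
      Subtype.coe_inj, EmbeddingLike.apply_eq_iff_eq, reduceCtorEq] at h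
    · rw [h]
    · have := congrArg Fin.val h; simp at this; rw [Fin.ext_iff.2 (by omega : (l : ℕ) = l')]
    · have := congrArg Fin.val h; simp at this; omega
    · have := congrArg Fin.val h; simp at this; omega
    · have := congrArg Fin.val h; simp at this; rw [Fin.ext_iff.2 (by omega : (l : ℕ) = l')]

/-- **The input-free form of `Q` in the `Sum` layout**: rename into the enlarged workspace,
then normalise with the `Sum`-layout flags. [cite: ChatterjeeTengse2023, Lemma 3.5 (v1: Lemma 42)] -/
def inputFree (Q : ProjCircuit k (ι ⊕ Fin w)) : ProjCircuit k (ι ⊕ Fin (w + 2 * Q.inputCount)) :=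
  Q.sumFlags.normalize (Q.renameCircuit (embed Q.inputCount))

omit [CommRing k] in
/-- The `Sum`-layout flags are fresh for the embedded circuit.
[cite: ChatterjeeTengse2023, Lemma 3.5 (v1: Lemma 42)] -/
theorem freshFor_sumFlags (Q : ProjCircuit k (ι ⊕ Fin w)) :
    Q.sumFlags.FreshFor (Q.renameCircuit (embed Q.inputCount)) := by
  have hread : ∀ j : Fin (2 * Q.inputCount), (Sum.inr (Fin.natAdd w j) : ι ⊕ Fin _) ∉
      (Q.renameCircuit (embed Q.inputCount)).varSet := fun j h => by
    obtain ⟨v, -, hv⟩ := Finset.mem_image.1 (Q.varSet_renameCircuit_subset _ h)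
    exact natAdd_notMem_range_embed _ j ⟨v, hv⟩
  have hproj : ∀ j : Fin (2 * Q.inputCount), (Sum.inr (Fin.natAdd w j) : ι ⊕ Fin _) ∉
      (Q.renameCircuit (embed Q.inputCount)).projVars := fun j h => by
    obtain ⟨v, -, hv⟩ := Q.projVars_renameCircuit_subset _ h
    exact natAdd_notMem_range_embed _ j ⟨v, hv⟩
  exact ⟨fun l => hread _, fun l => hread _, fun l => hproj _, fun l => hproj _⟩

/-- **It computes the (embedded) polynomial of `Q`.** [cite: ChatterjeeTengse2023, Lemma 3.5 (v1: Lemma 42)] -/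
theorem eval_inputFree (Q : ProjCircuit k (ι ⊕ Fin w)) :
    Q.inputFree.eval = rename (embed Q.inputCount) Q.eval := by
  rw [inputFree, Q.sumFlags.eval_normalize Q.freshFor_sumFlags,
    Q.eval_renameCircuit (embed_injective _)]

/-- **Size `2|Q| + 5M`**, `M` the number of touched inputs. [cite: ChatterjeeTengse2023, Lemma 3.5 (v1: Lemma 42)] -/
theorem size_inputFree (Q : ProjCircuit k (ι ⊕ Fin w)) :
    Q.inputFree.size = 2 * Q.size + 5 * Q.inputCount := by
  rw [inputFree, InputFlags.size_normalize, size_renameCircuit]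

/-- **Size at most `17|Q| + 5`** for fan-in-two circuits. [cite: ChatterjeeTengse2023, Lemma 3.5 (v1: Lemma 42)] -/
theorem size_inputFree_le {Q : ProjCircuit k (ι ⊕ Fin w)} (h2 : Q.IsFanInTwo) :
    Q.inputFree.size ≤ 17 * Q.size + 5 := by
  rw [size_inputFree]
  have := inputCount_le h2
  omega

/-- Fan-in two is kept. [cite: ChatterjeeTengse2023, Lemma 3.5 (v1: Lemma 42)] -/
theorem isFanInTwo_inputFree {Q : ProjCircuit k (ι ⊕ Fin w)} (h2 : Q.IsFanInTwo) :
    Q.inputFree.IsFanInTwo :=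
  Q.sumFlags.isFanInTwo_normalize (isFanInTwo_renameCircuit h2 _)

/-- Constant-freeness is kept. [cite: ChatterjeeTengse2023, Lemma 3.5 (v1: Lemma 42)] -/
theorem hasSignConstants_inputFree {Q : ProjCircuit k (ι ⊕ Fin w)} (h : Q.HasSignConstants) :
    Q.inputFree.HasSignConstants :=
  Q.sumFlags.hasSignConstants_normalize (hasSignConstants_renameCircuit h _)

/-- **The input-free form projects workspace variables only.**
[cite: ChatterjeeTengse2023, Def. 2.19 and Lemma 3.5 (v1: Def. 27, Lemma 42)] -/
theorem projVars_inputFree_subset (Q : ProjCircuit k (ι ⊕ Fin w)) :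
    Q.inputFree.projVars ⊆ Set.range Sum.inr := by
  intro v hv
  rcases Q.sumFlags.projVars_normalize_subset _ hv with ⟨hv1, hv2⟩ | ⟨l, rfl⟩ | ⟨l, rfl⟩
  · obtain ⟨u, hu, rfl⟩ := Q.projVars_renameCircuit_subset _ hv1
    cases u with
    | inl i =>
      exfalso
      apply hv2
      have hi : i ∈ Q.touched := by
        rw [touched, Finset.mem_toLeft]
        exact Finset.mem_union_right _ (mem_projFinset_iff.2 hu)
      refine ⟨Q.touched.equivFin ⟨i, hi⟩, ?_⟩
      simp [sumFlags, embed]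
    | inr j => exact ⟨_, rfl⟩
  · exact ⟨_, rfl⟩
  · exact ⟨_, rfl⟩

/-- **Input normalisation in the binder shape of `CT23_thm_3_1`.** A fan-in-two circuit with
projections over inputs `ι` and workspace `Fin w` computing an input polynomial
`rename Sum.inl U` can be replaced by one (workspace `Fin w'`) of size `≤ 17·size + 5`
computing the same `rename Sum.inl U`, fan-in two, constant-free if the original is, whose
projection gates bind WORKSPACE variables only (`projVars ⊆ range Sum.inr`) — the hypothesis under
which the printed substitution `C_G(pow(i))` of Lemma 3.5 is sound.
[cite: ChatterjeeTengse2023, Thm. 3.1 via Lemma 3.5 (v1: Lemma 42, p0015.txt:L80–L102)] -/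
theorem exists_inputFree_sum (Q : ProjCircuit k (ι ⊕ Fin w)) (h2 : Q.IsFanInTwo)
    (U : MvPolynomial ι k) (hU : Q.Computes (rename Sum.inl U)) :
    ∃ (w' : ℕ) (Q' : ProjCircuit k (ι ⊕ Fin w')), Q'.IsFanInTwo ∧ Q'.Computes (rename Sum.inl U) ∧
      Q'.size ≤ 17 * Q.size + 5 ∧ (Q.HasSignConstants → Q'.HasSignConstants) ∧
      Q'.projVars ⊆ Set.range Sum.inr := by
  refine ⟨_, Q.inputFree, isFanInTwo_inputFree h2, ?_, size_inputFree_le h2,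
    hasSignConstants_inputFree, Q.projVars_inputFree_subset⟩
  rw [Computes, eval_inputFree, show Q.eval = rename Sum.inl U from hU, rename_embed_rename_inl]

end SumLayout

end ProjCircuit

end Literature.Barriers.ValiantsHypothesis
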